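import Literature.NumberTheory.Automorphic.FontaineMazurGL2DyadicNearlyOrdinaryDihedral
import Literature.NumberTheory.Automorphic.FontaineMazurGL2PotCrystallineOrdinary
import Literature.NumberTheory.GaloisRepresentations.ResidualRepTwist
import Literature.NumberTheory.GaloisRepresentations.ResiduallyReducibleOfStableLine
import Literature.NumberTheory.GaloisRepresentations.TeichmullerLiftMonomial
import Literature.NumberTheory.GaloisRepresentations.SerreTrickTwistCharRat
import Literature.NumberTheory.Automorphic.LanglandsTunnellPadicCoefficients
import Literature.NumberTheory.Automorphic.WeightOneOrdinaryLiftGaloisProofs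
import Literature.NumberTheory.Automorphic.WeightOneOrdinaryLiftGaloisRamifiedProofs
import Literature.NumberTheory.Automorphic.WeightOneEigenvalueOfSplitLocalProofs
import Literature.NumberTheory.GaloisRepresentations.FiniteOrderTwistLanglandsTunnellInputs
import HarnessLib

/-!
# Allen 2014 for `F = ℚ`: the Tate twist folded into the named fact adds no strength, and the
# architecture of the printed proof (Theorem 93 + Lemma 87) — proofs only

A theorems-only companion (no definition of a notion, no named fact; D-0026) of
`Literature/NumberTheory/Automorphic/FontaineMazurGL2DyadicNearlyOrdinaryDihedral.lean`, written
by the seat of its named fact `Allen2014_modularity_nearlyOrdinaryDihedral_Q` (P. B. Allen,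
*Modularity of nearly ordinary 2-adic residually dihedral Galois representations*, Compositio
Math. 150 (2014) 1235–1346 = arXiv:1301.1113, Theorem of the Introduction, case `F = ℚ`).

The named fact renders Allen's hypotheses (1)–(2) on a Tate twist `ρ' = ρ ⊗ ε₂^a` of `ρ` and
concludes that a Tate twist of `ρ` is the Galois representation of a newform; its module
docstring justifies this by "hypotheses (3), (4), (5) and finite ramification are invariant under
Tate twists (`ε₂(c)² = 1`; `ε̄₂ = 1`, so `ρ ⊗ ε₂^a` and `ρ` have the same reductions; `ε₂` is
unramified away from `2`), so Allen's theorem applies to `ρ'`".  Here that bookkeeping is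
kernel-checked, in the pattern of the accepted
`Thorne2026_fontaineMazurGL2_potCrystallineOrdinary_iff_untwisted`:

* `Allen2014_modularity_nearlyOrdinaryDihedral_Q.of_untwisted` — the `a = 0` specialisation
  (the shape a discharge has to treat);
* `Allen2014_modularity_nearlyOrdinaryDihedral_Q_iff_untwisted` — the named fact is EQUIVALENT
  to that specialisation.  Ingredients: `ε₂^a` is trivial on inertia away from `2`
  (`eq_one_of_mem_inertia_of_eq_cyclotomicPadicAlgCl_zpow`, `FramedGaloisRep.isUnramifiedAt_twist`);
  oddness (`FramedRep.det_twist_apply`, `c² = 1`); and `ε̄₂ = 1` — the `2`-adic cyclotomic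
  character takes values in `ℤ₂ˣ = 1 + 2ℤ₂`, so `ρ ⊗ ε₂^a` has literally the same chosen
  residual representation as `ρ` (`FramedGaloisRep.residualRep_twist_cyclotomic_two`, by which
  (4) "solvable residual image" and (5) `AllenConditionFive` transfer by rewriting) and is
  residually absolutely irreducible together with `ρ`
  (`FramedGaloisRep.isResiduallyAbsIrreducible_twist_cyclotomic_two_iff`), both from
  `Literature/NumberTheory/GaloisRepresentations/ResidualRepTwist.lean`.

Companion bricks of the printed proof landed by the same seat:
`Literature/NumberTheory/GaloisRepresentations/ResiduallyReducibleOfStableLine.lean` (Allen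
§5.1.1's standing hypothesis "`ρ̄|_{G_v}` reducible for `v ∣ p`" from near-ordinarity (2)),
`…/ResidualRepTwist.lean`, `…/TeichmullerLiftMonomial.lean` (Lemma 87, first step),
`…/ResidualRepUnique.lean`.

## The architecture of the printed proof, for `F = ℚ` (section `Architecture`)

Allen, p. 3: "We will actually prove this with assumption (4) replaced by the assumption that
`ρ̄` is absolutely irreducible and admits a `2`-nearly ordinary modular lift, c.f. (finalthm). A
theorem of Wiles allows us to produce ordinary lifts in the residually dihedral case, cf.
(OrdinaryLift), and the main theorem follows."; p. 77, after the proof of Theorem 93: "Our theorem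
from the introduction is a result of (finalthm) above together with (OrdinaryLift)."  Here
(finalthm) = **Theorem 93** (§5.2, pp. 75–77: the Introduction Theorem with "(4) `ρ̄` is
absolutely irreducible; (5) If `L/F` is a CM extension such that `ρ̄|_{G_L}` is abelian, then
there is some `v ∣ 2` in `F` that does not split in `L`; (6) there is a `2`-nearly ordinary
regular algebraic cuspidal automorphic representation `π₀` of `GL_2(𝔸_F)` with `ρ̄_{π₀} ≅ ρ̄`")
and (OrdinaryLift) = **Lemma 87** (§5.1.1, pp. 69–70, under the standing hypotheses of §5.1.1
"`ρ̄ : G_F → GL_2(𝔽̄)` continuous absolutely irreducible such that for each `v ∣ p`, `ρ̄|_{G_v}`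
is reducible": "If `ρ̄` is dihedral, then it has a `χ̄`-good `p`-nearly ordinary regular
algebraic cuspidal lift").  In the pattern of the accepted
`BCDT.CDT_theorem_7_2_1_iff_lift_three` (`CDTTheorem712TwoLiftsProofs`: a named fact reduced to
the deep statements its printed proof invokes, carried as EXPLICIT HYPOTHESES, every glue step a
theorem of the tree; nothing here claims Theorem 93 or Lemma 87), this section kernel-checks that
top-level step for `F = ℚ`:

* `allenConditionFive_residualRep_iff_forall_quadratic` — under hypothesis (4) at `p = 2`
  (residually absolutely irreducible, solvable residual image) the tree's rendering
  `AllenConditionFive ρ̄` of the Introduction's (5) ("letting `L/F` denote THE unique quadratic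
  extension such that `ρ̄|_{G_L}` is abelian …") is EQUIVALENT to Theorem 93's printed (5) ("if
  `L/F` is a CM extension such that `ρ̄|_{G_L}` is abelian, then …", for every such `L`), by the
  uniqueness of the residual quadratic field in characteristic `2`
  (`eq_residualQuadraticField_of_charTwo`, Allen p. 2: "the image of a mod `2` dihedral
  representation has order not divisible by `4`").
* `Allen2014_modularity_nearlyOrdinaryDihedral_Q_iff_finalthm_solvable_of_ordinaryLift` —
  **granted Lemma 87 for `F = ℚ`, the named fact is EQUIVALENT to Theorem 93 for `F = ℚ`
  restricted to solvable residual image**, i.e. to itself with hypothesis (6) added: the glue is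
  "(4) at `p = 2` ⇒ `ρ̄` of dihedral type" (`FramedGaloisRep.isDihedralType_residualRep_of_isSolvable_two`),
  "(2) ⇒ `ρ̄|_{G_v}` reducible for `v ∣ 2`"
  (`FramedGaloisRep.IsOrdinaryOfWeightAt.hasCommonEigenvector_residualRep_comp`) and `ε̄₂ = 1`
  (`FramedGaloisRep.residualRep_twist_cyclotomic_two`), which feed Lemma 87, whose output is (6).
* `Allen2014_modularity_nearlyOrdinaryDihedral_Q_of_finalthm_of_ordinaryLift` — **the named fact
  from Theorem 93 (`F = ℚ`, hypotheses (1)–(6) as printed: (4) absolute irreducibility only, (5)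
  for every CM quadratic `L`) and Lemma 87 (`F = ℚ`, `p = 2`)**, p. 77 l. 10 verbatim.
* `Allen2014_modularity_nearlyOrdinaryDihedral_Q_of_finalthm_of_heckeWilesLift` (section
  `ArchitectureHeckeWiles`) — the same with Lemma 87 SPLIT at the point its printed proof
  changes sides (p. 70): its Galois half ("We first construct a totally odd dihedral
  representation … `ρ₁ = Ind χ ξ` … totally odd … `ρ₁|_{G_v} ≅ (χ'_v 0 ; 0 χ_v)`", Teichmüller
  lift, Serre's trick with the [ArtinTate X.5] character) is now a THEOREM of the tree over `ℚ`
  (`FramedGaloisRep.exists_odd_monomial_artinLift_diagonal_of_isOrdinaryOfWeightAt_two_rat`,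
  file `SerreTrickTwistCharRat`), so only its automorphic half remains as the hypothesis
  `hHW`: an odd Artin representation of `Γ_ℚ` induced from the quadratic field `L` and split
  at the place above `2` has a `2`-ordinary newform lift of weight `≥ 2` modulo `2` ("A
  classical construction yields a cuspidal [Hilbert] modular newform `f₁` of weight one with
  `ρ_{f₁} ≅ ρ₁` … `v`-stabilized … [WilesOrdinary, Thm. 3] … classical specialization at some
  parallel weight `k ≥ 2`" — Hecke's theta series and Wiles 1988, Thm. 3).
* `Allen2014_modularity_nearlyOrdinaryDihedral_Q_of_finalthm_of_langlandsTunnell_of_wilesLift`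
  (section `ArchitectureLanglandsTunnell`) — the same with `hHW` split at its first sentence:
  "A classical construction yields a cuspidal … newform `f₁` of weight one with `ρ_{f₁} ≅ ρ₁`"
  is supplied by the tree's EXISTING Langlands–Tunnell predicate `langlands_tunnell` (lang.S30;
  hypothesis `hLT : ∀ σ, langlands_tunnell σ`, as in `LanglandsTunnellModThree` / `BCDTTheoremB`),
  transported to the `2`-adic finite-image `ρ₁` through an abstract isomorphism `ℚ̄₂ ≅ ℂ`
  (`Automorphic/LanglandsTunnellPadicCoefficients`, `GaloisRepresentations/ArtinRepCoefficientTransport`;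
  solvable image because `ρ₁` is monomial, irreducible because it lifts `ρ̄`), leaving Wiles
  1988, Thm. 3 with the classicality of weight `≥ 2` ordinary specialisations as the hypothesis
  `hW` (`heckeWilesLift_of_langlands_tunnell_of_wilesLift`).  The inputs of the named fact absent
  from the tree as theorems are then exactly `h93` (Theorem 93), `hLT` (an existing tracked fact)
  and `hW`.
* `Allen2014_modularity_nearlyOrdinaryDihedral_Q_of_finalthm_of_langlandsTunnell_of_hida326_of_ramifiedWilesLift`
  — the same with `hW` PROVED in the case where `ρ₁` is unramified at `2` (the classical
  Deligne–Serre/Wiles ordinary lift, `Automorphic/WeightOneOrdinaryLiftGaloisProofs`, granted the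
  existing named fact `Hida2000_thm326_exists_galoisRep`), leaving Wiles's input only for weight-one
  newforms ramified at `2` (`hWram`).
* `Allen2014_modularity_nearlyOrdinaryDihedral_Q_of_finalthm_of_langlandsTunnell_of_hida326` — the
  same with NO input from Wiles 1988 at all: in the ramified case the weight-one form is replaced by
  the newform of the twist `ρ₁ ⊗ θ⁻¹` (`θ` globalising `χ₂` on inertia, residually trivial at
  `p = 2`), which is either unramified at `2` or `2`-ordinary by Deligne–Serre Thm. 4.6 (b)
  (`WeightOneEigenvalueOfSplitLocalProofs`, `WeightOneOrdinaryLiftGaloisRamifiedProofs`,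
  `FiniteOrderTwistLanglandsTunnellInputs`).  Remaining inputs: `h93`, `hLT`, `hH`.

Rendering of hypothesis (6) / of the conclusion of Lemma 87 ("`ρ̄` has a `2`-nearly ordinary
regular algebraic cuspidal lift `π₀`", Allen p. 34: `π` is `p`-nearly ordinary iff some
`0 ≠ x ∈ π^V` has `T_{ϖ_v} x = (p-adic unit) x` for each `v ∣ p`; p. 69: "`π` lifts `ρ̄` if
there is a `G_F`-stable lattice in `ρ_π` whose reduction is equal to `ρ̄`") in the tree's
classical vocabulary over `ℚ`, on the AUTOMORPHIC side so that no `p`-adic Hodge theory enters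
the dictionary: there are a newform `g ∈ S_{k₀}(Γ₁(N₀))`, `k₀ ≥ 2` (regular algebraic), an
embedding `ι_g : K_g → ℚ̄₂` under which `g` is ORDINARY at `2` (`‖ι_g(a₂(g))‖ = 1`: the
`U₂`-eigenvalue of the `2`-stabilised, resp. new, vector is a `2`-adic unit), a Galois
representation `ρ_g` attached to `g` away from `2N₀` (`IsGaloisRepOfNewform1`, as in the
conclusion of the named fact) and a finite-order character `θ` ("nearly ordinary" = ordinary up to
a finite-order twist, loc. cit. p. 34 with [HidaNOGalRep, Cor. 2.2]: `π_v = π(η_v|·|^{1/2}, μ_v|·|^{1/2})`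
or special with `ϖ_v^{-w} η_v(ϖ_v)` a unit; twist by a Dirichlet character with `2`-component
`η_v|_{ℤ₂^×}`) such that `ρ̄` is a residual representation of `ρ_g ⊗ θ` (`IsResidualRepOf`:
semisimplified reduction up to conjugacy — for the absolutely irreducible `ρ̄` at hand, Allen's
"reduction equal to `ρ̄` after extension of scalars").  With `π₀ := π_g ⊗ θ` this is (6) as
printed (Deligne's `ρ_g`; `ρ_{π₀}` and `ρ_g ⊗ θ` differ by a Tate twist, invisible residually as
`ε̄₂ = 1`).  The `χ̄`-goodness clause of Lemma 87 and the near-ordinarity of `ρ_{π₀}` at `2`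
((NearOrdGalRep), Wiles 1988 Thm. 2 / Hida 1989, Allen §2.4) are not restated (weaker).

## References

* P. B. Allen, Compositio Math. 150 (2014) 1235–1346, Theorem of the Introduction;
  arXiv:1301.1113, pp. 2–3; §5.1.1 Lemma 87 (pp. 69–70); §5.2 Theorem 93 (pp. 75–77) and the
  sentence following its proof (p. 77). [Allen2014]
* H. Hida, *Nearly ordinary Hecke algebras and Galois representations of several variables*,
  in *Algebraic analysis, geometry, and number theory* (1989), Cor. 2.2 (quoted by Allen, p. 34,
  as [HidaNOGalRep]).
* B. Conrad, F. Diamond, R. Taylor, J. Amer. Math. Soc. 12 (1999), Thm. 7.2.1 — the tree's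
  `CDTTheorem712TwoLiftsProofs`, the pattern followed here. [ConradDiamondTaylor1999]
-/

noncomputable section

open scoped MatrixGroups Matrix NumberField ModularForm
open NumberField IsDedekindDomain Field Filter CongruenceSubgroup

namespace Literature.NumberTheory.Automorphic

open Literature.NumberTheory.GaloisRepresentations
open Literature.NumberTheory.EllipticCurves.ModularForms

/-! ### The Tate twist adds no strength (kernel-checked bookkeeping of the rendering) -/

/-- **The untwisted case of Allen's theorem for `F = ℚ`** — the shape a discharge has to treat
(`a = 0`, `χ₀ = 1`): `ρ : Γ_ℚ → GL₂(ℚ̄₂)` continuous, unramified at all but finitely many places,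
odd, residually absolutely irreducible with solvable residual image, satisfying Allen's
condition (5), and ITSELF Skinner–Wiles-ordinary of some weight `k ≥ 2` at the place above `2`
with `det ρ · ε₂^{1-k}` of finite order; then `ρ` is modular up to a Tate twist.  Proved from
`(h : Allen2014_modularity_nearlyOrdinaryDihedral_Q)` by instantiating the twist with the trivial
character (`FramedRep.twist_one`).
[cite: Allen2014, Theorem of the Introduction (arXiv:1301.1113, p. 2)] -/
theorem Allen2014_modularity_nearlyOrdinaryDihedral_Q.of_untwisted
    (h : Allen2014_modularity_nearlyOrdinaryDihedral_Q) (ρ : FramedGaloisRep ℚ (PadicAlgCl 2) 2)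
    (hunr : ∀ᶠ v : HeightOneSpectrum (𝓞 ℚ) in cofinite, ρ.IsUnramifiedAt v) (hodd : ρ.IsOdd)
    (hirr : ρ.IsResiduallyAbsIrreducible) (hsolv : IsSolvable ρ.residualRep.range)
    (h5 : AllenConditionFive ρ.residualRep) {k m : ℕ} (hk : 2 ≤ k) (hm : 0 < m)
    (hord : ∀ v : HeightOneSpectrum (𝓞 ℚ), ((2 : ℕ) : 𝓞 ℚ) ∈ v.asIdeal →
      FramedGaloisRep.IsOrdinaryOfWeightAt 2 ρ v k m)
    (hdet : ∃ n : ℕ, 0 < n ∧ ∀ σ,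
      (FramedRep.det ρ σ * (cyclotomicPadicAlgCl ℚ 2 σ ^ ((k : ℤ) - 1))⁻¹) ^ n = 1) :
    ∃ (χ : absoluteGaloisGroup ℚ →ₜ* (PadicAlgCl 2)ˣ) (m : ℤ),
      (∀ σ, χ σ = cyclotomicPadicAlgCl ℚ 2 σ ^ m) ∧
      ∃ (N : ℕ) (_ : NeZero N) (k : ℤ) (f : CuspForm (Gamma1 N) k)
        (ιf : coeffCharField f →+* PadicAlgCl 2),
        IsNewform1 f ∧ IsGaloisRepOfNewform1 f ιf {q | q ∣ N * 2} (FramedRep.twist ρ χ) := by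
  refine h ρ hunr hodd hirr hsolv h5 ⟨1, 0, k, m, fun σ => ?_, hk, hm, fun v hv => ?_, ?_⟩
  · rw [ContinuousMonoidHom.coe_one, Pi.one_apply, zpow_zero]
  · rw [FramedRep.twist_one]
    exact hord v hv
  · rw [FramedRep.twist_one]
    exact hdet

/-- **The Tate twist folded into `Allen2014_modularity_nearlyOrdinaryDihedral_Q` adds no
strength: the named fact is EQUIVALENT to its untwisted (`a = 0`, `χ₀ = 1`) specialisation**
(the shape of `Allen2014_modularity_nearlyOrdinaryDihedral_Q.of_untwisted`).  This is the
kernel-checked form of the bookkeeping asserted in the module docstring ("hypotheses (3), (4),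
(5) and finite ramification are invariant under Tate twists"): given `ρ` and a Tate twist
`ρ' = ρ ⊗ ε₂^a` satisfying (1)–(2), `ρ'` is again a.e. unramified (`ε₂^a` is trivial on inertia
at `v ∤ 2`, `eq_one_of_mem_inertia_of_eq_cyclotomicPadicAlgCl_zpow`), odd
(`det (ρ ⊗ χ₀)(c) = χ₀(c)² det ρ(c)`, `c² = 1`), and — because `ε₂` takes values in
`ℤ₂ˣ = 1 + 2ℤ₂`, i.e. `ε̄₂ = 1` — has literally the same chosen residual representation
(`FramedGaloisRep.residualRep_twist_cyclotomic_two`: (4) and (5) transfer by rewriting) and is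
residually absolutely irreducible together with `ρ`
(`FramedGaloisRep.isResiduallyAbsIrreducible_twist_cyclotomic_two_iff`); the untwisted statement
makes `ρ' ⊗ ε₂^m` modular and `ρ' ⊗ ε₂^m = ρ ⊗ ε₂^{m+a}` (`FramedRep.twist_twist`).  A discharge
of the named fact need only treat `a = 0`.
[cite: Allen2014, Theorem of the Introduction (arXiv:1301.1113, p. 2)] -/
theorem Allen2014_modularity_nearlyOrdinaryDihedral_Q_iff_untwisted :
    Allen2014_modularity_nearlyOrdinaryDihedral_Q ↔
      ∀ (ρ : FramedGaloisRep ℚ (PadicAlgCl 2) 2),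
        (∀ᶠ v : HeightOneSpectrum (𝓞 ℚ) in cofinite, ρ.IsUnramifiedAt v) → ρ.IsOdd →
        ρ.IsResiduallyAbsIrreducible → IsSolvable ρ.residualRep.range →
        AllenConditionFive ρ.residualRep →
        ∀ (k m : ℕ), 2 ≤ k → 0 < m →
        (∀ v : HeightOneSpectrum (𝓞 ℚ), ((2 : ℕ) : 𝓞 ℚ) ∈ v.asIdeal →
          FramedGaloisRep.IsOrdinaryOfWeightAt 2 ρ v k m) →
        (∃ n : ℕ, 0 < n ∧ ∀ σ,
          (FramedRep.det ρ σ * (cyclotomicPadicAlgCl ℚ 2 σ ^ ((k : ℤ) - 1))⁻¹) ^ n = 1) →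
        ∃ (χ : absoluteGaloisGroup ℚ →ₜ* (PadicAlgCl 2)ˣ) (m : ℤ),
          (∀ σ, χ σ = cyclotomicPadicAlgCl ℚ 2 σ ^ m) ∧
          ∃ (N : ℕ) (_ : NeZero N) (k : ℤ) (f : CuspForm (Gamma1 N) k)
            (ιf : coeffCharField f →+* PadicAlgCl 2),
            IsNewform1 f ∧ IsGaloisRepOfNewform1 f ιf {q | q ∣ N * 2} (FramedRep.twist ρ χ) := by
  refine ⟨fun h ρ hunr hodd hirr hsolv h5 k m hk hm hord hdet =>
      h.of_untwisted ρ hunr hodd hirr hsolv h5 hk hm hord hdet,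
    fun H ρ hunr hodd hirr hsolv h5 ⟨χ₀, a, k, m, hχ₀, hk, hm, hord, hdet⟩ => ?_⟩
  -- the finitely many places above `2`
  have hfin : {v : HeightOneSpectrum (𝓞 ℚ) | ((2 : ℕ) : 𝓞 ℚ) ∈ v.asIdeal}.Finite := by
    have hp0 : (Ideal.span {((2 : ℕ) : 𝓞 ℚ)} : Ideal (𝓞 ℚ)) ≠ ⊥ := by
      rw [Ne, Ideal.span_singleton_eq_bot]
      exact_mod_cast (Fact.out : (2 : ℕ).Prime).ne_zero
    exact (Ideal.finite_factors hp0).subset fun v hv => Ideal.dvd_span_singleton.2 hv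
  -- `ρ ⊗ ε₂^a` is a.e. unramified and odd together with `ρ`
  have hunr₁ : ∀ᶠ v : HeightOneSpectrum (𝓞 ℚ) in cofinite,
      FramedGaloisRep.IsUnramifiedAt v (FramedRep.twist ρ χ₀) := by
    filter_upwards [hunr, hfin.compl_mem_cofinite] with v hv hpv
    exact FramedGaloisRep.isUnramifiedAt_twist hv fun 𝔓 h𝔓 σ hσ =>
      eq_one_of_mem_inertia_of_eq_cyclotomicPadicAlgCl_zpow hχ₀ hpv h𝔓 hσ
  have hodd₁ : FramedGaloisRep.IsOdd (FramedRep.twist ρ χ₀) := by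
    intro φ c hc
    have h2 : χ₀ c ^ 2 = 1 := by rw [← map_pow, hc.sq_eq_one, map_one]
    rw [FramedRep.det_twist_apply, hodd φ c hc, h2, one_mul]
  -- `ε̄₂ = 1`: the residual hypotheses (4), (5) are literally those of `ρ`
  have hres : FramedGaloisRep.residualRep (FramedRep.twist ρ χ₀) = ρ.residualRep :=
    FramedGaloisRep.residualRep_twist_cyclotomic_two hχ₀
  have hirr₁ : FramedGaloisRep.IsResiduallyAbsIrreducible (FramedRep.twist ρ χ₀) :=
    (FramedGaloisRep.isResiduallyAbsIrreducible_twist_cyclotomic_two_iff hχ₀).2 hirr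
  have hsolv₁ : IsSolvable (FramedGaloisRep.residualRep (FramedRep.twist ρ χ₀)).range := by
    rw [hres]
    exact hsolv
  have h5₁ : AllenConditionFive (FramedGaloisRep.residualRep (FramedRep.twist ρ χ₀)) := by
    rw [hres]
    exact h5
  obtain ⟨χ, m', hχ, N, hN, k', f, ιf, hnew, hgal⟩ :=
    H (FramedRep.twist ρ χ₀) hunr₁ hodd₁ hirr₁ hsolv₁ h5₁ k m hk hm hord hdet
  refine ⟨χ * χ₀, m' + a, fun σ => ?_, N, hN, k', f, ιf, hnew, ?_⟩
  · rw [ContinuousMonoidHom.mul_apply, hχ σ, hχ₀ σ, zpow_add]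
  · rwa [FramedRep.twist_twist] at hgal

/-! ### The architecture of the printed proof for `F = ℚ`:
Introduction Theorem = Theorem 93 (finalthm) + Lemma 87 (OrdinaryLift) -/

section Architecture

/-- **Under hypothesis (4) at `p = 2`, the tree's condition (5) is Theorem 93's printed (5).**
For `ρ : Γ_ℚ → GL₂(ℚ̄₂)` residually absolutely irreducible with solvable residual image,
`AllenConditionFive ρ̄` (`ρ̄ = ρ.residualRep`; "letting `L/F` denote the unique quadratic
extension such that `ρ̄|_{G_L}` is abelian, if `L/F` is CM, then there is some `v ∣ 2` in `F`
that does not split in `L`", Introduction, Theorem, (5), with `L = residualQuadraticField ρ̄`)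
holds if and only if: for EVERY quadratic `L ⊆ ℚ̄` such that `ρ̄(Gal(ℚ̄/L))` is commutative and
`L` is totally complex, some `v ∣ 2` of `ℚ` has at most one prime of `𝓞_L` above it (Theorem 93,
(5): "If `L/F` is a CM extension such that `ρ̄|_{G_L}` is abelian, then there is some `v ∣ 2` in
`F` that does not split in `L`").  Proof: (4) at `p = 2` makes `ρ̄` of dihedral type with finite
image and no common eigenvector (`FramedGaloisRep.isDihedralType_residualRep_of_isSolvable_two`),
so such an `L` is unique and equals `residualQuadraticField ρ̄`
(`eq_residualQuadraticField_of_charTwo` — Allen, p. 2: "the extension `L/F` in assumption (5) is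
unique since … the image of a mod `2` dihedral representation has order not divisible by `4`"),
which is itself quadratic with `ρ̄(Gal(ℚ̄/L))` commutative (`finrank_residualQuadraticField`,
`commute_of_mem_fixingSubgroup_residualQuadraticField`; the kernel of `ρ̄` is open,
`FramedGaloisRep.isOpen_ker_of_isResidualRepOf`).
[cite: Allen2014, Introduction, Theorem (5) and the paragraph before it (arXiv:1301.1113, p. 2), and Theorem 93 (5) (p. 76)] -/
theorem allenConditionFive_residualRep_iff_forall_quadratic
    (ρ : FramedGaloisRep ℚ (PadicAlgCl 2) 2) (hirr : ρ.IsResiduallyAbsIrreducible)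
    (hsolv : IsSolvable ρ.residualRep.range) :
    AllenConditionFive ρ.residualRep ↔
      ∀ L : IntermediateField ℚ (AlgebraicClosure ℚ), Module.finrank ℚ L = 2 →
        (∀ σ ∈ (L.fixingSubgroup : Subgroup (absoluteGaloisGroup ℚ)),
          ∀ τ ∈ (L.fixingSubgroup : Subgroup (absoluteGaloisGroup ℚ)),
            Commute (ρ.residualRep σ) (ρ.residualRep τ)) →
        IsTotallyComplex L →
          ∃ v : HeightOneSpectrum (𝓞 ℚ), ((2 : ℕ) : 𝓞 ℚ) ∈ v.asIdeal ∧
            (v.asIdeal.primesOver (𝓞 L)).Subsingleton := by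
  obtain ⟨hspec, hfin, hce, hdih⟩ := ρ.isDihedralType_residualRep_of_isSolvable_two hirr hsolv
  haveI := hfin
  haveI : IsAlgClosed (padicAlgClResidueField 2) :=
    Literature.RingTheory.Valuation.isAlgClosed_residueField (padicAlgClIntegers 2)
  haveI : CharP (padicAlgClResidueField 2) 2 := charP_padicAlgClResidueField_two
  have hker : IsOpen (ρ.residualRep.ker : Set (absoluteGaloisGroup ℚ)) :=
    FramedGaloisRep.isOpen_ker_of_isResidualRepOf hspec
  refine ⟨fun h5 L hL hcomm htc => ?_, fun H htc => ?_⟩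
  · obtain rfl : L = residualQuadraticField ρ.residualRep :=
      eq_residualQuadraticField_of_charTwo hdih hce hL hcomm
    exact h5 htc
  · exact H _ (finrank_residualQuadraticField hdih hker)
      (fun σ hσ τ hτ => commute_of_mem_fixingSubgroup_residualQuadraticField hdih hker hσ hτ) htc

/-- **Granted Lemma 87 (OrdinaryLift) for `F = ℚ`, the named fact is EQUIVALENT to Theorem 93
(finalthm) for `F = ℚ` restricted to solvable residual image** — that is, to itself with
Theorem 93's extra hypothesis (6) "`ρ̄` has a `2`-nearly ordinary regular algebraic cuspidal
lift" inserted (rendered as in the module docstring: a newform `g` of weight `k₀ ≥ 2`, ordinary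
at `2` under `ι_g : K_g → ℚ̄₂`, a Galois representation `ρ_g` attached to `g` away from `2N₀`,
and a finite-order `θ` with `ρ̄` a residual representation of `ρ_g ⊗ θ`).

The hypothesis `h87` is Lemma 87 for `F = ℚ`, `p = 2` (§5.1.1, pp. 69–70, with the standing
hypotheses of §5.1.1): for `ρ̄ = ρ.residualRep` absolutely irreducible (a genuine reduction of
`ρ`, `ρ.IsResiduallyAbsIrreducible`), of dihedral type ("`ρ̄` is dihedral") and reducible on the
decomposition group at the place above `2` ("for each `v ∣ p`, `ρ̄|_{G_v}` is reducible":
a common eigenvector along `Γ_{ℚ₂} → Γ_ℚ`, `absGaloisRestrict`), `ρ̄` has such a lift — the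
`χ̄`-goodness clause dropped.  (A dihedral `ρ̄ : G_ℚ → GL₂(𝔽̄₂)` with open kernel is the
residual representation of its Teichmüller lift, `FramedGaloisRep.exists_artinLift_of_isDihedralType`
of `TeichmullerLiftMonomial`, so quantifying over `ρ` rather than over `ρ̄` loses nothing here.)

`→`: forget (6).  `←` (the content; Allen p. 3: "We will actually prove this with assumption (4)
replaced by the assumption that `ρ̄` is absolutely irreducible and admits a `2`-nearly ordinary
modular lift … A theorem of Wiles allows us to produce ordinary lifts in the residually dihedral
case, cf. (OrdinaryLift), and the main theorem follows"): given the hypotheses of the named fact,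
(4) at `p = 2` makes `ρ̄` of dihedral type
(`FramedGaloisRep.isDihedralType_residualRep_of_isSolvable_two`); the near-ordinarity (2) of the
Tate twist `ρ ⊗ ε₂^a` makes ITS residual representation reducible at the place above `2`
(`FramedGaloisRep.IsOrdinaryOfWeightAt.hasCommonEigenvector_residualRep_comp`, Allen §5.1.1),
and that residual representation is literally `ρ̄` because `ε̄₂ = 1`
(`FramedGaloisRep.residualRep_twist_cyclotomic_two`); so `h87` supplies (6) and Theorem 93
(solvable case) concludes.
[cite: Allen2014, Lemma 87 (arXiv:1301.1113, §5.1.1, pp. 69–70), Theorem 93 (§5.2, pp. 75–77) and p. 77 ("Our theorem from the introduction is a result of (finalthm) above together with (OrdinaryLift)")] -/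
theorem Allen2014_modularity_nearlyOrdinaryDihedral_Q_iff_finalthm_solvable_of_ordinaryLift
    (h87 : ∀ ρ : FramedGaloisRep ℚ (PadicAlgCl 2) 2, ρ.IsResiduallyAbsIrreducible →
      IsDihedralType ρ.residualRep →
      (∀ v : HeightOneSpectrum (𝓞 ℚ), ((2 : ℕ) : 𝓞 ℚ) ∈ v.asIdeal →
        HasCommonEigenvector
          (ρ.residualRep.comp (absGaloisRestrict ℚ (v.adicCompletion ℚ)).toMonoidHom)) →
      ∃ (N₀ : ℕ) (_ : NeZero N₀) (k₀ : ℤ) (g : CuspForm (Gamma1 N₀) k₀)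
        (ιg : coeffCharField g →+* PadicAlgCl 2) (ρg : FramedGaloisRep ℚ (PadicAlgCl 2) 2)
        (θ : absoluteGaloisGroup ℚ →ₜ* (PadicAlgCl 2)ˣ),
        2 ≤ k₀ ∧ IsNewform1 g ∧
        ‖ιg ⟨(UpperHalfPlane.qExpansion 1 ⇑g).coeff 2, cuspCoeff_mem_coeffCharField g 2⟩‖ = 1 ∧
        IsGaloisRepOfNewform1 g ιg {q | q ∣ N₀ * 2} ρg ∧
        (∃ n : ℕ, 0 < n ∧ ∀ σ, θ σ ^ n = 1) ∧
        FramedGaloisRep.IsResidualRepOf (FramedRep.twist ρg θ) (RingHom.id _) ρ.residualRep) :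
    Allen2014_modularity_nearlyOrdinaryDihedral_Q ↔
      ∀ (ρ : FramedGaloisRep ℚ (PadicAlgCl 2) 2),
        (∀ᶠ v : HeightOneSpectrum (𝓞 ℚ) in cofinite, ρ.IsUnramifiedAt v) → ρ.IsOdd →
        ρ.IsResiduallyAbsIrreducible → IsSolvable ρ.residualRep.range →
        AllenConditionFive ρ.residualRep →
        -- (6): `ρ̄` has a `2`-nearly ordinary regular algebraic cuspidal (modular) lift
        (∃ (N₀ : ℕ) (_ : NeZero N₀) (k₀ : ℤ) (g : CuspForm (Gamma1 N₀) k₀)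
          (ιg : coeffCharField g →+* PadicAlgCl 2) (ρg : FramedGaloisRep ℚ (PadicAlgCl 2) 2)
          (θ : absoluteGaloisGroup ℚ →ₜ* (PadicAlgCl 2)ˣ),
          2 ≤ k₀ ∧ IsNewform1 g ∧
          ‖ιg ⟨(UpperHalfPlane.qExpansion 1 ⇑g).coeff 2, cuspCoeff_mem_coeffCharField g 2⟩‖ = 1 ∧
          IsGaloisRepOfNewform1 g ιg {q | q ∣ N₀ * 2} ρg ∧
          (∃ n : ℕ, 0 < n ∧ ∀ σ, θ σ ^ n = 1) ∧
          FramedGaloisRep.IsResidualRepOf (FramedRep.twist ρg θ) (RingHom.id _) ρ.residualRep) →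
        (∃ (χ₀ : absoluteGaloisGroup ℚ →ₜ* (PadicAlgCl 2)ˣ) (a : ℤ) (k m : ℕ),
          (∀ σ, χ₀ σ = cyclotomicPadicAlgCl ℚ 2 σ ^ a) ∧ 2 ≤ k ∧ 0 < m ∧
          (∀ v : HeightOneSpectrum (𝓞 ℚ), ((2 : ℕ) : 𝓞 ℚ) ∈ v.asIdeal →
            FramedGaloisRep.IsOrdinaryOfWeightAt 2 (FramedRep.twist ρ χ₀) v k m) ∧
          ∃ n : ℕ, 0 < n ∧ ∀ σ,
            (FramedRep.det (FramedRep.twist ρ χ₀) σ *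
              (cyclotomicPadicAlgCl ℚ 2 σ ^ ((k : ℤ) - 1))⁻¹) ^ n = 1) →
        ∃ (χ : absoluteGaloisGroup ℚ →ₜ* (PadicAlgCl 2)ˣ) (m : ℤ),
          (∀ σ, χ σ = cyclotomicPadicAlgCl ℚ 2 σ ^ m) ∧
          ∃ (N : ℕ) (_ : NeZero N) (k : ℤ) (f : CuspForm (Gamma1 N) k)
            (ιf : coeffCharField f →+* PadicAlgCl 2),
            IsNewform1 f ∧ IsGaloisRepOfNewform1 f ιf {q | q ∣ N * 2} (FramedRep.twist ρ χ) := by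
  refine ⟨fun h ρ hunr hodd hirr hsolv h5 _ h12 => h ρ hunr hodd hirr hsolv h5 h12,
    fun H ρ hunr hodd hirr hsolv h5 h12 => ?_⟩
  obtain ⟨χ₀, a, k, m, hχ₀, hk, hm, hord, hdet⟩ := h12
  -- (4) at `p = 2`: `ρ̄` is of dihedral type
  have hdih : IsDihedralType ρ.residualRep :=
    (ρ.isDihedralType_residualRep_of_isSolvable_two hirr hsolv).2.2.2
  -- (2) for `ρ ⊗ ε₂^a`, and `ε̄₂ = 1`: `ρ̄|_{G_v}` is reducible at the place above `2`
  have hred : ∀ v : HeightOneSpectrum (𝓞 ℚ), ((2 : ℕ) : 𝓞 ℚ) ∈ v.asIdeal →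
      HasCommonEigenvector
        (ρ.residualRep.comp (absGaloisRestrict ℚ (v.adicCompletion ℚ)).toMonoidHom) := by
    intro v hv
    have h := (hord v hv).hasCommonEigenvector_residualRep_comp
    rwa [FramedGaloisRep.residualRep_twist_cyclotomic_two hχ₀] at h
  -- Lemma 87 supplies (6); Theorem 93 (solvable residual image) concludes
  exact H ρ hunr hodd hirr hsolv h5 (h87 ρ hirr hdih hred) ⟨χ₀, a, k, m, hχ₀, hk, hm, hord, hdet⟩

/-- **Allen 2014, Theorem of the Introduction for `F = ℚ`, from Theorem 93 (finalthm) and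
Lemma 87 (OrdinaryLift)** — p. 77: "Our theorem from the introduction is a result of (finalthm)
above together with (OrdinaryLift)."  The two inputs are carried as explicit hypotheses, in the
tree's vocabulary for `F = ℚ` (Tate twist folded into (1)–(2) exactly as in the named fact):

* `h93` — **Theorem 93** (§5.2, pp. 75–77) for `F = ℚ`: `ρ : Γ_ℚ → GL₂(ℚ̄₂)` continuous and
  finitely ramified; (1)–(2) some Tate twist `ρ ⊗ ε₂^a` is nearly ordinary of weight `k ≥ 2` at
  the place above `2` with `det · ε₂^{1-k}` of finite order; (3) odd; (4) "`ρ̄` is absolutely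
  irreducible" (NO solvability); (5) "If `L/F` is a CM extension such that `ρ̄|_{G_L}` is abelian,
  then there is some `v ∣ 2` in `F` that does not split in `L`" (every quadratic `L ⊆ ℚ̄` with
  `ρ̄(Gal(ℚ̄/L))` commutative and `L` totally complex); (6) "there is a `2`-nearly ordinary regular
  algebraic cuspidal automorphic representation `π₀` of `GL₂(𝔸_F)` with `ρ̄_{π₀} ≅ ρ̄`" (module
  docstring: newform `g` of weight `≥ 2` ordinary at `2` under `ι_g`, `ρ_g`, finite-order `θ`,
  `ρ̄` a residual representation of `ρ_g ⊗ θ`); conclusion "`ρ` is modular" rendered as in the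
  named fact (a Tate twist of `ρ` is attached to a newform away from `2N`).
* `h87` — **Lemma 87** (§5.1.1, pp. 69–70) for `F = ℚ`, `p = 2`, as in
  `Allen2014_modularity_nearlyOrdinaryDihedral_Q_iff_finalthm_solvable_of_ordinaryLift`.

Proof: by that equivalence it suffices to prove Theorem 93 in the solvable case with the tree's
(5), which is `h93` with (5) transported by
`allenConditionFive_residualRep_iff_forall_quadratic`.  Nothing here claims `h93` or `h87`
(Theorem 93 is Allen's `R^red = T` theorem over a solvable totally real base change of `ℚ` plus
descent; Lemma 87 needs weight-one theta series, [ArtinTate, X Thm. 5] and Wiles 1988, Thm. 3).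
[cite: Allen2014, Theorem 93 (arXiv:1301.1113, §5.2, pp. 75–77), Lemma 87 (§5.1.1, pp. 69–70), and p. 77 l. 10] -/
theorem Allen2014_modularity_nearlyOrdinaryDihedral_Q_of_finalthm_of_ordinaryLift
    (h93 : ∀ (ρ : FramedGaloisRep ℚ (PadicAlgCl 2) 2),
      (∀ᶠ v : HeightOneSpectrum (𝓞 ℚ) in cofinite, ρ.IsUnramifiedAt v) →
      -- (1), (2) for a Tate twist `ρ ⊗ ε₂^a`, weight `k ≥ 2`
      (∃ (χ₀ : absoluteGaloisGroup ℚ →ₜ* (PadicAlgCl 2)ˣ) (a : ℤ) (k m : ℕ),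
        (∀ σ, χ₀ σ = cyclotomicPadicAlgCl ℚ 2 σ ^ a) ∧ 2 ≤ k ∧ 0 < m ∧
        (∀ v : HeightOneSpectrum (𝓞 ℚ), ((2 : ℕ) : 𝓞 ℚ) ∈ v.asIdeal →
          FramedGaloisRep.IsOrdinaryOfWeightAt 2 (FramedRep.twist ρ χ₀) v k m) ∧
        ∃ n : ℕ, 0 < n ∧ ∀ σ,
          (FramedRep.det (FramedRep.twist ρ χ₀) σ *
            (cyclotomicPadicAlgCl ℚ 2 σ ^ ((k : ℤ) - 1))⁻¹) ^ n = 1) →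
      -- (3)
      ρ.IsOdd →
      -- (4): absolutely irreducible residual representation
      ρ.IsResiduallyAbsIrreducible →
      -- (5): every CM quadratic `L` on which `ρ̄` is abelian has a non-split place above `2`
      (∀ L : IntermediateField ℚ (AlgebraicClosure ℚ), Module.finrank ℚ L = 2 →
        (∀ σ ∈ (L.fixingSubgroup : Subgroup (absoluteGaloisGroup ℚ)),
          ∀ τ ∈ (L.fixingSubgroup : Subgroup (absoluteGaloisGroup ℚ)),
            Commute (ρ.residualRep σ) (ρ.residualRep τ)) →
        IsTotallyComplex L →
          ∃ v : HeightOneSpectrum (𝓞 ℚ), ((2 : ℕ) : 𝓞 ℚ) ∈ v.asIdeal ∧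
            (v.asIdeal.primesOver (𝓞 L)).Subsingleton) →
      -- (6): a `2`-nearly ordinary regular algebraic cuspidal lift of `ρ̄`
      (∃ (N₀ : ℕ) (_ : NeZero N₀) (k₀ : ℤ) (g : CuspForm (Gamma1 N₀) k₀)
        (ιg : coeffCharField g →+* PadicAlgCl 2) (ρg : FramedGaloisRep ℚ (PadicAlgCl 2) 2)
        (θ : absoluteGaloisGroup ℚ →ₜ* (PadicAlgCl 2)ˣ),
        2 ≤ k₀ ∧ IsNewform1 g ∧
        ‖ιg ⟨(UpperHalfPlane.qExpansion 1 ⇑g).coeff 2, cuspCoeff_mem_coeffCharField g 2⟩‖ = 1 ∧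
        IsGaloisRepOfNewform1 g ιg {q | q ∣ N₀ * 2} ρg ∧
        (∃ n : ℕ, 0 < n ∧ ∀ σ, θ σ ^ n = 1) ∧
        FramedGaloisRep.IsResidualRepOf (FramedRep.twist ρg θ) (RingHom.id _) ρ.residualRep) →
      ∃ (χ : absoluteGaloisGroup ℚ →ₜ* (PadicAlgCl 2)ˣ) (m : ℤ),
        (∀ σ, χ σ = cyclotomicPadicAlgCl ℚ 2 σ ^ m) ∧
        ∃ (N : ℕ) (_ : NeZero N) (k : ℤ) (f : CuspForm (Gamma1 N) k)
          (ιf : coeffCharField f →+* PadicAlgCl 2),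
          IsNewform1 f ∧ IsGaloisRepOfNewform1 f ιf {q | q ∣ N * 2} (FramedRep.twist ρ χ))
    (h87 : ∀ ρ : FramedGaloisRep ℚ (PadicAlgCl 2) 2, ρ.IsResiduallyAbsIrreducible →
      IsDihedralType ρ.residualRep →
      (∀ v : HeightOneSpectrum (𝓞 ℚ), ((2 : ℕ) : 𝓞 ℚ) ∈ v.asIdeal →
        HasCommonEigenvector
          (ρ.residualRep.comp (absGaloisRestrict ℚ (v.adicCompletion ℚ)).toMonoidHom)) →
      ∃ (N₀ : ℕ) (_ : NeZero N₀) (k₀ : ℤ) (g : CuspForm (Gamma1 N₀) k₀)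
        (ιg : coeffCharField g →+* PadicAlgCl 2) (ρg : FramedGaloisRep ℚ (PadicAlgCl 2) 2)
        (θ : absoluteGaloisGroup ℚ →ₜ* (PadicAlgCl 2)ˣ),
        2 ≤ k₀ ∧ IsNewform1 g ∧
        ‖ιg ⟨(UpperHalfPlane.qExpansion 1 ⇑g).coeff 2, cuspCoeff_mem_coeffCharField g 2⟩‖ = 1 ∧
        IsGaloisRepOfNewform1 g ιg {q | q ∣ N₀ * 2} ρg ∧
        (∃ n : ℕ, 0 < n ∧ ∀ σ, θ σ ^ n = 1) ∧
        FramedGaloisRep.IsResidualRepOf (FramedRep.twist ρg θ) (RingHom.id _) ρ.residualRep) :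
    Allen2014_modularity_nearlyOrdinaryDihedral_Q :=
  (Allen2014_modularity_nearlyOrdinaryDihedral_Q_iff_finalthm_solvable_of_ordinaryLift h87).2
    fun ρ hunr hodd hirr hsolv h5 h6 h12 =>
      h93 ρ hunr h12 hodd hirr
        ((allenConditionFive_residualRep_iff_forall_quadratic ρ hirr hsolv).1 h5) h6

end Architecture

/-! ### Lemma 87 split at p. 70: Galois half proved, automorphic half (Hecke–Wiles) assumed -/

section ArchitectureHeckeWiles

/-- `ℚ` has a finite place above `2` (the prime `(2)` of `𝓞 ℚ = ℤ`). [folklore] -/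
theorem exists_heightOneSpectrum_two_mem_asIdeal :
    ∃ v : HeightOneSpectrum (𝓞 ℚ), ((2 : ℕ) : 𝓞 ℚ) ∈ v.asIdeal := by
  have h2 : ¬ IsUnit ((2 : ℕ) : 𝓞 ℚ) := by
    intro h
    have h' := h.map Rat.ringOfIntegersEquiv
    rw [map_natCast] at h'
    have h'' := Int.isUnit_iff.mp h'
    omega
  have hne : Ideal.span {((2 : ℕ) : 𝓞 ℚ)} ≠ ⊤ := by
    rwa [Ne, Ideal.span_singleton_eq_top]
  obtain ⟨M, hM, hle⟩ := Ideal.exists_le_maximal _ hne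
  have hmem : ((2 : ℕ) : 𝓞 ℚ) ∈ M := hle (Ideal.mem_span_singleton_self _)
  have hbot : M ≠ ⊥ := fun h => by
    rw [h, Ideal.mem_bot] at hmem
    exact two_ne_zero (by exact_mod_cast hmem : (2 : 𝓞 ℚ) = 0)
  exact ⟨⟨M, hM.isPrime, hbot⟩, hmem⟩

/-- **Allen 2014, Theorem of the Introduction for `F = ℚ`, from Theorem 93 (finalthm) and the
AUTOMORPHIC half of Lemma 87 (OrdinaryLift)** — the refinement of
`Allen2014_modularity_nearlyOrdinaryDihedral_Q_of_finalthm_of_ordinaryLift` in which the Galois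
half of Lemma 87 is no longer assumed but supplied by the tree's theorem
`FramedGaloisRep.exists_odd_monomial_artinLift_diagonal_of_isOrdinaryOfWeightAt_two_rat`
(Teichmüller lift `Ind χ` of the dihedral `ρ̄`, Serre's trick `ρ₁ = Ind χ ξ` with the explicit
Kummer character `ξ` over `ℚ`, oddness, `ρ₁|_{G_v} ≅ χ'_v ⊕ χ_v`; Allen pp. 69–70 up to the
displayed formula on p. 70).

* `h93` — **Theorem 93** for `F = ℚ`, exactly as in
  `Allen2014_modularity_nearlyOrdinaryDihedral_Q_of_finalthm_of_ordinaryLift`.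
* `hHW` — **Lemma 87, automorphic half, for `F = ℚ`, `p = 2`** (p. 70, from "A classical
  construction yields a cuspidal Hilbert modular newform `f₁` of weight `((1,…,1),(0,…,0))`,
  such that `ρ_{f₁} ≅ ρ₁`" to the end of the proof: `(π_{f₁})_v = π(χ'_v, χ_v)`,
  `v`-stabilisation, "[WilesOrdinary, Theorem 3] allows us to insert `f₁` in an ordinary `p`-adic
  analytic family and letting `f_k` denote a classical specialization at some parallel weight
  `k ≥ 2` … `T_{ϖ_v} f_k = α_v f_k` for some `α_k` congruent to `χ̄_v(ϖ_v)`.  The automorphic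
  representation generated by this `f_k` is then a `χ̄`-good lift of `ρ̄`"): for every continuous
  `ρ₁ : Γ_ℚ → GL₂(ℚ̄₂)` with finite image (open kernel) and integral model `ρ₀'` which is
  INDUCED from the quadratic field `L = ℚ̄^{Hm}` (`Hm ≤ Γ_ℚ` open of index two, `ρ₀'` diagonal on
  `Hm` and antidiagonal off `Hm`: `ρ₁ ≅ Ind_{G_L}^{G_ℚ} ψ`, whence Hecke's weight-one theta
  series `f₁`), totally odd, lifting an irreducible `τ : Γ_ℚ → GL₂(\bar 𝔽₂)` (so `f₁` is
  cuspidal), and split at the place `v` above `2`, `ρ₁|_{Γ_{ℚ_v}} ≅ χ'_v ⊕ χ_v` with `χ'_v, χ_v`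
  continuous of finite order (`(π_{f₁})_v` a principal series), the residual representation `τ`
  has a `2`-ordinary regular algebraic cuspidal lift in the rendering of hypothesis (6) (module
  docstring: newform `g` of weight `k₀ ≥ 2`, `‖ι_g(a₂(g))‖ = 1`, `ρ_g`, finite-order `θ`, `τ` a
  residual representation of `ρ_g ⊗ θ`).  The `χ̄`-goodness refinement is dropped (weaker
  conclusion), as in (6).

Proof (p. 77 l. 10 with p. 70): given the hypotheses of the named fact, (2) for the Tate twist
`ρ ⊗ ε₂^a` at the place `v₂ ∋ 2` (`exists_heightOneSpectrum_two_mem_asIdeal`) and (4) at `p = 2`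
feed the Galois half, whose output — for `ρ ⊗ ε₂^a`, whose residual representation is `ρ̄`
(`ε̄₂ = 1`, `FramedGaloisRep.residualRep_twist_cyclotomic_two`) — is the input of `hHW`; `hHW`
returns (6) for `ρ̄`, and Theorem 93 (with (5) transported by
`allenConditionFive_residualRep_iff_forall_quadratic`) concludes.  Nothing here claims `h93` or
`hHW` (Theorem 93 is Allen's `R^red = T` theorem; `hHW` is Hecke 1926/1927 + Wiles 1988 Thm. 3
with Hida's control at weight `k ≥ 2`).
[cite: Allen2014, Lemma 87 (arXiv:1301.1113, §5.1.1, pp. 69–70), Theorem 93 (§5.2, pp. 75–77) and p. 77 l. 10] -/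
theorem Allen2014_modularity_nearlyOrdinaryDihedral_Q_of_finalthm_of_heckeWilesLift
    (h93 : ∀ (ρ : FramedGaloisRep ℚ (PadicAlgCl 2) 2),
      (∀ᶠ v : HeightOneSpectrum (𝓞 ℚ) in cofinite, ρ.IsUnramifiedAt v) →
      (∃ (χ₀ : absoluteGaloisGroup ℚ →ₜ* (PadicAlgCl 2)ˣ) (a : ℤ) (k m : ℕ),
        (∀ σ, χ₀ σ = cyclotomicPadicAlgCl ℚ 2 σ ^ a) ∧ 2 ≤ k ∧ 0 < m ∧
        (∀ v : HeightOneSpectrum (𝓞 ℚ), ((2 : ℕ) : 𝓞 ℚ) ∈ v.asIdeal →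
          FramedGaloisRep.IsOrdinaryOfWeightAt 2 (FramedRep.twist ρ χ₀) v k m) ∧
        ∃ n : ℕ, 0 < n ∧ ∀ σ,
          (FramedRep.det (FramedRep.twist ρ χ₀) σ *
            (cyclotomicPadicAlgCl ℚ 2 σ ^ ((k : ℤ) - 1))⁻¹) ^ n = 1) →
      ρ.IsOdd →
      ρ.IsResiduallyAbsIrreducible →
      (∀ L : IntermediateField ℚ (AlgebraicClosure ℚ), Module.finrank ℚ L = 2 →
        (∀ σ ∈ (L.fixingSubgroup : Subgroup (absoluteGaloisGroup ℚ)),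
          ∀ τ ∈ (L.fixingSubgroup : Subgroup (absoluteGaloisGroup ℚ)),
            Commute (ρ.residualRep σ) (ρ.residualRep τ)) →
        IsTotallyComplex L →
          ∃ v : HeightOneSpectrum (𝓞 ℚ), ((2 : ℕ) : 𝓞 ℚ) ∈ v.asIdeal ∧
            (v.asIdeal.primesOver (𝓞 L)).Subsingleton) →
      (∃ (N₀ : ℕ) (_ : NeZero N₀) (k₀ : ℤ) (g : CuspForm (Gamma1 N₀) k₀)
        (ιg : coeffCharField g →+* PadicAlgCl 2) (ρg : FramedGaloisRep ℚ (PadicAlgCl 2) 2)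
        (θ : absoluteGaloisGroup ℚ →ₜ* (PadicAlgCl 2)ˣ),
        2 ≤ k₀ ∧ IsNewform1 g ∧
        ‖ιg ⟨(UpperHalfPlane.qExpansion 1 ⇑g).coeff 2, cuspCoeff_mem_coeffCharField g 2⟩‖ = 1 ∧
        IsGaloisRepOfNewform1 g ιg {q | q ∣ N₀ * 2} ρg ∧
        (∃ n : ℕ, 0 < n ∧ ∀ σ, θ σ ^ n = 1) ∧
        FramedGaloisRep.IsResidualRepOf (FramedRep.twist ρg θ) (RingHom.id _) ρ.residualRep) →
      ∃ (χ : absoluteGaloisGroup ℚ →ₜ* (PadicAlgCl 2)ˣ) (m : ℤ),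
        (∀ σ, χ σ = cyclotomicPadicAlgCl ℚ 2 σ ^ m) ∧
        ∃ (N : ℕ) (_ : NeZero N) (k : ℤ) (f : CuspForm (Gamma1 N) k)
          (ιf : coeffCharField f →+* PadicAlgCl 2),
          IsNewform1 f ∧ IsGaloisRepOfNewform1 f ιf {q | q ∣ N * 2} (FramedRep.twist ρ χ))
    (hHW : ∀ (ρ₁ : FramedGaloisRep ℚ (PadicAlgCl 2) 2)
      (ρ₀' : absoluteGaloisGroup ℚ →* GL (Fin 2) (padicAlgClIntegers 2))
      (Hm : Subgroup (absoluteGaloisGroup ℚ))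
      (τ : absoluteGaloisGroup ℚ →* GL (Fin 2) (padicAlgClResidueField 2)),
      -- `ρ₁` continuous with finite image and integral model `ρ₀'` …
      (∀ σ, Matrix.GeneralLinearGroup.map (padicAlgClIntegers 2).subtype (ρ₀' σ) = ρ₁ σ) →
      IsOpen ((ρ₁ : absoluteGaloisGroup ℚ →* GL (Fin 2) (PadicAlgCl 2)).ker :
        Set (absoluteGaloisGroup ℚ)) →
      -- … induced from the quadratic field `L = ℚ̄^{Hm}` (`ρ₁ ≅ Ind_{G_L}^{G_ℚ} ψ`) …
      IsOpen (Hm : Set (absoluteGaloisGroup ℚ)) → Hm.index = 2 →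
      (∀ h ∈ Hm, (ρ₀' h).val 0 1 = 0 ∧ (ρ₀' h).val 1 0 = 0) →
      (∀ g ∉ Hm, (ρ₀' g).val 0 0 = 0 ∧ (ρ₀' g).val 1 1 = 0) →
      -- … totally odd, lifting the irreducible `τ` …
      ρ₁.IsOdd → ¬ HasCommonEigenvector τ → ρ₁.IsReductionOf (RingHom.id _) τ →
      -- … and split at the place above `2`: `ρ₁|_{G_v} ≅ χ'_v ⊕ χ_v`, finite order, continuous
      (∃ v : HeightOneSpectrum (𝓞 ℚ), ((2 : ℕ) : 𝓞 ℚ) ∈ v.asIdeal ∧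
        ∃ (P : GL (Fin 2) (PadicAlgCl 2))
          (χ₁ χ₂ : absoluteGaloisGroup (v.adicCompletion ℚ) →* padicAlgClIntegers 2) (n : ℕ),
          0 < n ∧
          (∀ σ, (P⁻¹ * ρ₁.toLocal v σ * P).val =
            Matrix.diagonal ![(χ₁ σ : PadicAlgCl 2), (χ₂ σ : PadicAlgCl 2)]) ∧
          (∀ σ, (χ₁ σ : PadicAlgCl 2) ^ n = 1 ∧ (χ₂ σ : PadicAlgCl 2) ^ n = 1) ∧
          Continuous (fun σ => (χ₁ σ : PadicAlgCl 2)) ∧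
          Continuous (fun σ => (χ₂ σ : PadicAlgCl 2))) →
      -- THEN (Hecke + `v`-stabilisation + Wiles 1988 Thm. 3): a `2`-ordinary newform lift of `τ`
      ∃ (N₀ : ℕ) (_ : NeZero N₀) (k₀ : ℤ) (g : CuspForm (Gamma1 N₀) k₀)
        (ιg : coeffCharField g →+* PadicAlgCl 2) (ρg : FramedGaloisRep ℚ (PadicAlgCl 2) 2)
        (θ : absoluteGaloisGroup ℚ →ₜ* (PadicAlgCl 2)ˣ),
        2 ≤ k₀ ∧ IsNewform1 g ∧
        ‖ιg ⟨(UpperHalfPlane.qExpansion 1 ⇑g).coeff 2, cuspCoeff_mem_coeffCharField g 2⟩‖ = 1 ∧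
        IsGaloisRepOfNewform1 g ιg {q | q ∣ N₀ * 2} ρg ∧
        (∃ n : ℕ, 0 < n ∧ ∀ σ, θ σ ^ n = 1) ∧
        FramedGaloisRep.IsResidualRepOf (FramedRep.twist ρg θ) (RingHom.id _) τ) :
    Allen2014_modularity_nearlyOrdinaryDihedral_Q := by
  intro ρ hunr hodd hirr hsolv h5 h12
  obtain ⟨χ₀, a, k, m, hχ₀, hk, hm, hord, hdet⟩ := h12
  -- the place above `2`, and the Tate twist `ρ' = ρ ⊗ ε₂^a`, which has the same reduction
  obtain ⟨v₂, hv₂⟩ := exists_heightOneSpectrum_two_mem_asIdeal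
  have hreseq : FramedGaloisRep.residualRep (FramedRep.twist ρ χ₀) = ρ.residualRep :=
    FramedGaloisRep.residualRep_twist_cyclotomic_two hχ₀
  have hirr' : FramedGaloisRep.IsResiduallyAbsIrreducible (FramedRep.twist ρ χ₀) :=
    (FramedGaloisRep.isResiduallyAbsIrreducible_twist_cyclotomic_two_iff hχ₀).2 hirr
  have hsolv' : IsSolvable (FramedGaloisRep.residualRep (FramedRep.twist ρ χ₀)).range := by
    rw [hreseq]
    exact hsolv
  -- (4) at `p = 2`: `ρ̄` has no common eigenvector
  have hce : ¬ HasCommonEigenvector ρ.residualRep :=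
    (ρ.isDihedralType_residualRep_of_isSolvable_two hirr hsolv).2.2.1
  -- the Galois half of Lemma 87 (proved): odd induced Artin lift, split at `v₂`
  obtain ⟨ρ₁, ρ₀', Hm, N, hN, hmap, hopen, hred, -, hodd1, hHo, hHi, -, hdg, had, Q, P, χ₁, χ₂,
    -, h1, h2, -, h4, h5'⟩ :=
    FramedGaloisRep.exists_odd_monomial_artinLift_diagonal_of_isOrdinaryOfWeightAt_two_rat
      (FramedRep.twist ρ χ₀) hirr' hsolv' v₂ (hord v₂ hv₂)
  rw [hreseq] at hred
  -- the automorphic half: (6) for `ρ̄`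
  obtain ⟨N₀, hN₀, k₀, g, ιg, ρg, θ, h6⟩ := hHW ρ₁ ρ₀' Hm ρ.residualRep hmap hopen hHo hHi hdg had
    hodd1 hce hred ⟨v₂, hv₂, P, χ₁, χ₂, 2 * N, by omega, h1, h2, h4, h5'⟩
  -- Theorem 93 concludes
  exact h93 ρ hunr ⟨χ₀, a, k, m, hχ₀, hk, hm, hord, hdet⟩ hodd hirr
    ((allenConditionFive_residualRep_iff_forall_quadratic ρ hirr hsolv).1 h5)
    ⟨N₀, hN₀, k₀, g, ιg, ρg, θ, h6⟩

end ArchitectureHeckeWiles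

/-! ### Lemma 87's automorphic half split at its first sentence: Langlands–Tunnell + Wiles 1988 -/

section ArchitectureLanglandsTunnell

/-- **The automorphic half `hHW` of Lemma 87 over `ℚ` from Langlands–Tunnell and Wiles's
ordinary families.**  Allen p. 70 splits the automorphic half of Lemma 87 into

* (Hecke) "A classical construction yields a cuspidal Hilbert modular newform `f₁` of weight
  `((1,…,1),(0,…,0))`, such that `ρ_{f₁} ≅ ρ₁`" — over `ℚ` and for the odd monomial lift `ρ₁`
  (solvable image: diagonal on the index-two `Hm`; irreducible: it lifts the irreducible `τ`)
  this is the tree's Langlands–Tunnell predicate `langlands_tunnell` (lang.S30), transported to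
  the `2`-adic `ρ₁` by `exists_weightOne_newform_of_isReductionOf_of_monomial`
  (`Automorphic/LanglandsTunnellPadicCoefficients`: abstract `ψ : ℚ̄₂ ≅ ℂ`, finite image), and
* (Wiles) the rest: "`(π_{f₁})_v` is the principal series `π(χ'_v, χ_v)` … we replace `f₁` with
  the `v`-stabilized eigenform … `T_{ϖ_v} f₁ = χ_v(ϖ_v) f₁` … [WilesOrdinary, Theorem 3] allows us
  to insert `f₁` in an ordinary `p`-adic analytic family and letting `f_k` denote a classical
  specialization at some parallel weight `k ≥ 2`, for each `v ∣ p` we have `T_{ϖ_v} f_k = α_v f_k`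
  for some `α_k` congruent to `χ̄_v(ϖ_v)`.  The automorphic representation generated by this `f_k`
  is then a `χ̄`-good lift of `ρ̄`" — carried as the explicit hypothesis `hW`, in the tree's
  classical vocabulary over `ℚ`: for every weight-one NEWFORM `f₁ ∈ S₁(Γ₁(N₁))` with `2`-adic
  representation `ρ₁` (`IsGaloisRepOfNewform1 f₁ ι₁ {q ∣ N₁} ρ₁`) lifting a `τ` without common
  eigenvector and split at the place above `2` with finite-order continuous characters
  (`ρ₁|_{Γ_{ℚ₂}} ≅ χ'₂ ⊕ χ₂`, i.e. `(π_{f₁})₂` a principal series and `f₁` ordinary at `2` up to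
  twist), `τ` has a `2`-ordinary newform lift of weight `k₀ ≥ 2` in the rendering of (6) (module
  docstring; the finite-order `θ` absorbs the nearly-ordinary twist and the `χ̄`-goodness is
  dropped).

so `hHW` of `Allen2014_modularity_nearlyOrdinaryDihedral_Q_of_finalthm_of_heckeWilesLift` follows
from `∀ σ, langlands_tunnell σ` and `hW`.  Nothing here claims `langlands_tunnell` (its closed debt is
`strongArtin_of_isSolvable` — for the dihedral `ρ₁` at hand `strongArtin_of_isDihedralType`,
Jacquet–Langlands §12 / Hecke — with `frobSatakeCompatibleAt_of_isPiOfArtinRep` and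
`exists_isNewform1_of_isPiOfArtinRep`, `Automorphic/StrongArtinGL2`) or `hW` (Wiles, Invent. Math.
94 (1988), Thm. 3, with the classicality of ordinary specialisations of weight `≥ 2`, loc. cit. and
Hida, Ann. of Math. 128 (1988); absent from the tree).
[cite: Allen2014, Lemma 87 (arXiv:1301.1113v2, §5.1.1, p. 70)] -/
theorem heckeWilesLift_of_langlands_tunnell_of_wilesLift (hLT : ∀ σ, langlands_tunnell σ)
    (hW : ∀ (N₁ : ℕ) [NeZero N₁] (f₁ : CuspForm (Gamma1 N₁) 1)
      (ι₁ : coeffCharField f₁ →+* PadicAlgCl 2) (ρ₁ : FramedGaloisRep ℚ (PadicAlgCl 2) 2)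
      (τ : absoluteGaloisGroup ℚ →* GL (Fin 2) (padicAlgClResidueField 2)),
      IsNewform1 f₁ → IsGaloisRepOfNewform1 f₁ ι₁ {q | q ∣ N₁} ρ₁ →
      ¬ HasCommonEigenvector τ → ρ₁.IsReductionOf (RingHom.id _) τ →
      (∃ v : HeightOneSpectrum (𝓞 ℚ), ((2 : ℕ) : 𝓞 ℚ) ∈ v.asIdeal ∧
        ∃ (P : GL (Fin 2) (PadicAlgCl 2))
          (χ₁ χ₂ : absoluteGaloisGroup (v.adicCompletion ℚ) →* padicAlgClIntegers 2) (n : ℕ),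
          0 < n ∧
          (∀ σ, (P⁻¹ * ρ₁.toLocal v σ * P).val =
            Matrix.diagonal ![(χ₁ σ : PadicAlgCl 2), (χ₂ σ : PadicAlgCl 2)]) ∧
          (∀ σ, (χ₁ σ : PadicAlgCl 2) ^ n = 1 ∧ (χ₂ σ : PadicAlgCl 2) ^ n = 1) ∧
          Continuous (fun σ => (χ₁ σ : PadicAlgCl 2)) ∧
          Continuous (fun σ => (χ₂ σ : PadicAlgCl 2))) →
      ∃ (N₀ : ℕ) (_ : NeZero N₀) (k₀ : ℤ) (g : CuspForm (Gamma1 N₀) k₀)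
        (ιg : coeffCharField g →+* PadicAlgCl 2) (ρg : FramedGaloisRep ℚ (PadicAlgCl 2) 2)
        (θ : absoluteGaloisGroup ℚ →ₜ* (PadicAlgCl 2)ˣ),
        2 ≤ k₀ ∧ IsNewform1 g ∧
        ‖ιg ⟨(UpperHalfPlane.qExpansion 1 ⇑g).coeff 2, cuspCoeff_mem_coeffCharField g 2⟩‖ = 1 ∧
        IsGaloisRepOfNewform1 g ιg {q | q ∣ N₀ * 2} ρg ∧
        (∃ n : ℕ, 0 < n ∧ ∀ σ, θ σ ^ n = 1) ∧
        FramedGaloisRep.IsResidualRepOf (FramedRep.twist ρg θ) (RingHom.id _) τ) :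
    ∀ (ρ₁ : FramedGaloisRep ℚ (PadicAlgCl 2) 2)
      (ρ₀' : absoluteGaloisGroup ℚ →* GL (Fin 2) (padicAlgClIntegers 2))
      (Hm : Subgroup (absoluteGaloisGroup ℚ))
      (τ : absoluteGaloisGroup ℚ →* GL (Fin 2) (padicAlgClResidueField 2)),
      (∀ σ, Matrix.GeneralLinearGroup.map (padicAlgClIntegers 2).subtype (ρ₀' σ) = ρ₁ σ) →
      IsOpen ((ρ₁ : absoluteGaloisGroup ℚ →* GL (Fin 2) (PadicAlgCl 2)).ker :
        Set (absoluteGaloisGroup ℚ)) →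
      IsOpen (Hm : Set (absoluteGaloisGroup ℚ)) → Hm.index = 2 →
      (∀ h ∈ Hm, (ρ₀' h).val 0 1 = 0 ∧ (ρ₀' h).val 1 0 = 0) →
      (∀ g ∉ Hm, (ρ₀' g).val 0 0 = 0 ∧ (ρ₀' g).val 1 1 = 0) →
      ρ₁.IsOdd → ¬ HasCommonEigenvector τ → ρ₁.IsReductionOf (RingHom.id _) τ →
      (∃ v : HeightOneSpectrum (𝓞 ℚ), ((2 : ℕ) : 𝓞 ℚ) ∈ v.asIdeal ∧
        ∃ (P : GL (Fin 2) (PadicAlgCl 2))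
          (χ₁ χ₂ : absoluteGaloisGroup (v.adicCompletion ℚ) →* padicAlgClIntegers 2) (n : ℕ),
          0 < n ∧
          (∀ σ, (P⁻¹ * ρ₁.toLocal v σ * P).val =
            Matrix.diagonal ![(χ₁ σ : PadicAlgCl 2), (χ₂ σ : PadicAlgCl 2)]) ∧
          (∀ σ, (χ₁ σ : PadicAlgCl 2) ^ n = 1 ∧ (χ₂ σ : PadicAlgCl 2) ^ n = 1) ∧
          Continuous (fun σ => (χ₁ σ : PadicAlgCl 2)) ∧
          Continuous (fun σ => (χ₂ σ : PadicAlgCl 2))) →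
      ∃ (N₀ : ℕ) (_ : NeZero N₀) (k₀ : ℤ) (g : CuspForm (Gamma1 N₀) k₀)
        (ιg : coeffCharField g →+* PadicAlgCl 2) (ρg : FramedGaloisRep ℚ (PadicAlgCl 2) 2)
        (θ : absoluteGaloisGroup ℚ →ₜ* (PadicAlgCl 2)ˣ),
        2 ≤ k₀ ∧ IsNewform1 g ∧
        ‖ιg ⟨(UpperHalfPlane.qExpansion 1 ⇑g).coeff 2, cuspCoeff_mem_coeffCharField g 2⟩‖ = 1 ∧
        IsGaloisRepOfNewform1 g ιg {q | q ∣ N₀ * 2} ρg ∧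
        (∃ n : ℕ, 0 < n ∧ ∀ σ, θ σ ^ n = 1) ∧
        FramedGaloisRep.IsResidualRepOf (FramedRep.twist ρg θ) (RingHom.id _) τ := by
  intro ρ₁ ρ₀' Hm τ hmap hopen _ hHi hdg _ hodd hce hred hloc
  -- (Hecke / Langlands–Tunnell): the weight-one newform of the odd monomial lift `ρ₁`
  obtain ⟨N₁, hN₁, f₁, ι₁, hf₁, hρ₁⟩ :=
    exists_weightOne_newform_of_isReductionOf_of_monomial hLT ρ₁ ρ₀' hmap hopen Hm hHi hdg hodd
      hred hce
  -- (Wiles): ordinary family through `f₁`, classical weight-`k₀` specialisation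
  exact hW N₁ f₁ ι₁ ρ₁ τ hf₁ hρ₁ hce hred hloc

/-- **Allen 2014, Theorem of the Introduction for `F = ℚ`, from Theorem 93 (finalthm),
Langlands–Tunnell, and Wiles's ordinary families** — the refinement of
`Allen2014_modularity_nearlyOrdinaryDihedral_Q_of_finalthm_of_heckeWilesLift` in which the first
sentence of the automorphic half of Lemma 87 ("A classical construction yields a cuspidal …
newform `f₁` of weight one such that `ρ_{f₁} ≅ ρ₁`", p. 70) is no longer assumed but supplied by
the tree's Langlands–Tunnell predicate `langlands_tunnell` (lang.S30,
`Automorphic/LanglandsTunnell`; for the `2`-adic finite-image `ρ₁` via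
`Automorphic/LanglandsTunnellPadicCoefficients`).  After this, the inputs of the named fact
`Allen2014_modularity_nearlyOrdinaryDihedral_Q` that are NOT theorems of the tree are exactly:

* `h93` — Allen's **Theorem 93** for `F = ℚ` (`R^red = T` over a solvable totally real base
  change of `ℚ`, plus descent), as in
  `Allen2014_modularity_nearlyOrdinaryDihedral_Q_of_finalthm_of_ordinaryLift`;
* `hLT` — the Langlands–Tunnell theorem `∀ σ, langlands_tunnell σ`, an EXISTING predicate-fact of
  the tree whose closed debt is `strongArtin_of_isSolvable` (here only its dihedral case
  `strongArtin_of_isDihedralType` is exercised), `frobSatakeCompatibleAt_of_isPiOfArtinRep` and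
  `exists_isNewform1_of_isPiOfArtinRep` (`langlands_tunnell_of_strongArtin`);
* `hW` — **Wiles 1988, Thm. 3** (an ordinary `2`-adic family through the ordinary
  `2`-stabilisation of a weight-one newform, `p = 2` allowed) with the classicality and
  ordinarity of its weight `≥ 2` specialisations, exactly as used on p. 70 (see
  `heckeWilesLift_of_langlands_tunnell_of_wilesLift`).

The Galois half of Lemma 87 (Teichmüller lift, Serre's trick with the explicit Kummer character
over `ℚ`, oddness, the local shape at `2`) is the tree's theorem
`FramedGaloisRep.exists_odd_monomial_artinLift_diagonal_of_isOrdinaryOfWeightAt_two_rat`.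
Nothing here claims `h93`, `hLT` or `hW`.
[cite: Allen2014, Theorem 93 (arXiv:1301.1113v2, §5.2, pp. 75–77), Lemma 87 (§5.1.1, pp. 69–70) and p. 77 l. 10] -/
theorem Allen2014_modularity_nearlyOrdinaryDihedral_Q_of_finalthm_of_langlandsTunnell_of_wilesLift
    (h93 : ∀ (ρ : FramedGaloisRep ℚ (PadicAlgCl 2) 2),
      (∀ᶠ v : HeightOneSpectrum (𝓞 ℚ) in cofinite, ρ.IsUnramifiedAt v) →
      (∃ (χ₀ : absoluteGaloisGroup ℚ →ₜ* (PadicAlgCl 2)ˣ) (a : ℤ) (k m : ℕ),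
        (∀ σ, χ₀ σ = cyclotomicPadicAlgCl ℚ 2 σ ^ a) ∧ 2 ≤ k ∧ 0 < m ∧
        (∀ v : HeightOneSpectrum (𝓞 ℚ), ((2 : ℕ) : 𝓞 ℚ) ∈ v.asIdeal →
          FramedGaloisRep.IsOrdinaryOfWeightAt 2 (FramedRep.twist ρ χ₀) v k m) ∧
        ∃ n : ℕ, 0 < n ∧ ∀ σ,
          (FramedRep.det (FramedRep.twist ρ χ₀) σ *
            (cyclotomicPadicAlgCl ℚ 2 σ ^ ((k : ℤ) - 1))⁻¹) ^ n = 1) →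
      ρ.IsOdd →
      ρ.IsResiduallyAbsIrreducible →
      (∀ L : IntermediateField ℚ (AlgebraicClosure ℚ), Module.finrank ℚ L = 2 →
        (∀ σ ∈ (L.fixingSubgroup : Subgroup (absoluteGaloisGroup ℚ)),
          ∀ τ ∈ (L.fixingSubgroup : Subgroup (absoluteGaloisGroup ℚ)),
            Commute (ρ.residualRep σ) (ρ.residualRep τ)) →
        IsTotallyComplex L →
          ∃ v : HeightOneSpectrum (𝓞 ℚ), ((2 : ℕ) : 𝓞 ℚ) ∈ v.asIdeal ∧
            (v.asIdeal.primesOver (𝓞 L)).Subsingleton) →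
      (∃ (N₀ : ℕ) (_ : NeZero N₀) (k₀ : ℤ) (g : CuspForm (Gamma1 N₀) k₀)
        (ιg : coeffCharField g →+* PadicAlgCl 2) (ρg : FramedGaloisRep ℚ (PadicAlgCl 2) 2)
        (θ : absoluteGaloisGroup ℚ →ₜ* (PadicAlgCl 2)ˣ),
        2 ≤ k₀ ∧ IsNewform1 g ∧
        ‖ιg ⟨(UpperHalfPlane.qExpansion 1 ⇑g).coeff 2, cuspCoeff_mem_coeffCharField g 2⟩‖ = 1 ∧
        IsGaloisRepOfNewform1 g ιg {q | q ∣ N₀ * 2} ρg ∧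
        (∃ n : ℕ, 0 < n ∧ ∀ σ, θ σ ^ n = 1) ∧
        FramedGaloisRep.IsResidualRepOf (FramedRep.twist ρg θ) (RingHom.id _) ρ.residualRep) →
      ∃ (χ : absoluteGaloisGroup ℚ →ₜ* (PadicAlgCl 2)ˣ) (m : ℤ),
        (∀ σ, χ σ = cyclotomicPadicAlgCl ℚ 2 σ ^ m) ∧
        ∃ (N : ℕ) (_ : NeZero N) (k : ℤ) (f : CuspForm (Gamma1 N) k)
          (ιf : coeffCharField f →+* PadicAlgCl 2),
          IsNewform1 f ∧ IsGaloisRepOfNewform1 f ιf {q | q ∣ N * 2} (FramedRep.twist ρ χ))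
    (hLT : ∀ σ, langlands_tunnell σ)
    (hW : ∀ (N₁ : ℕ) [NeZero N₁] (f₁ : CuspForm (Gamma1 N₁) 1)
      (ι₁ : coeffCharField f₁ →+* PadicAlgCl 2) (ρ₁ : FramedGaloisRep ℚ (PadicAlgCl 2) 2)
      (τ : absoluteGaloisGroup ℚ →* GL (Fin 2) (padicAlgClResidueField 2)),
      IsNewform1 f₁ → IsGaloisRepOfNewform1 f₁ ι₁ {q | q ∣ N₁} ρ₁ →
      ¬ HasCommonEigenvector τ → ρ₁.IsReductionOf (RingHom.id _) τ →
      (∃ v : HeightOneSpectrum (𝓞 ℚ), ((2 : ℕ) : 𝓞 ℚ) ∈ v.asIdeal ∧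
        ∃ (P : GL (Fin 2) (PadicAlgCl 2))
          (χ₁ χ₂ : absoluteGaloisGroup (v.adicCompletion ℚ) →* padicAlgClIntegers 2) (n : ℕ),
          0 < n ∧
          (∀ σ, (P⁻¹ * ρ₁.toLocal v σ * P).val =
            Matrix.diagonal ![(χ₁ σ : PadicAlgCl 2), (χ₂ σ : PadicAlgCl 2)]) ∧
          (∀ σ, (χ₁ σ : PadicAlgCl 2) ^ n = 1 ∧ (χ₂ σ : PadicAlgCl 2) ^ n = 1) ∧
          Continuous (fun σ => (χ₁ σ : PadicAlgCl 2)) ∧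
          Continuous (fun σ => (χ₂ σ : PadicAlgCl 2))) →
      ∃ (N₀ : ℕ) (_ : NeZero N₀) (k₀ : ℤ) (g : CuspForm (Gamma1 N₀) k₀)
        (ιg : coeffCharField g →+* PadicAlgCl 2) (ρg : FramedGaloisRep ℚ (PadicAlgCl 2) 2)
        (θ : absoluteGaloisGroup ℚ →ₜ* (PadicAlgCl 2)ˣ),
        2 ≤ k₀ ∧ IsNewform1 g ∧
        ‖ιg ⟨(UpperHalfPlane.qExpansion 1 ⇑g).coeff 2, cuspCoeff_mem_coeffCharField g 2⟩‖ = 1 ∧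
        IsGaloisRepOfNewform1 g ιg {q | q ∣ N₀ * 2} ρg ∧
        (∃ n : ℕ, 0 < n ∧ ∀ σ, θ σ ^ n = 1) ∧
        FramedGaloisRep.IsResidualRepOf (FramedRep.twist ρg θ) (RingHom.id _) τ) :
    Allen2014_modularity_nearlyOrdinaryDihedral_Q :=
  Allen2014_modularity_nearlyOrdinaryDihedral_Q_of_finalthm_of_heckeWilesLift h93
    (heckeWilesLift_of_langlands_tunnell_of_wilesLift hLT hW)

end ArchitectureLanglandsTunnell

/-! ### The automorphic half split further: the UNRAMIFIED half of Wiles's input proved classically -/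

section ArchitectureClassicalLift

/-- **`hW` restricted to the ramified case suffices**: the automorphic half `hHW` of Lemma 87 over
`ℚ` follows from Langlands–Tunnell (`hLT`), Deligne's `2`-adic representation of a newform of weight
`≥ 2` through a prescribed embedding (`hH : Hida2000_thm326_exists_galoisRep`, an EXISTING named fact
of the tree) and Wiles's input `hWram` for weight-one newforms whose `2`-adic representation is
RAMIFIED at `2` only.  Indeed when `ρ₁ = ρ_{f₁}` is UNRAMIFIED at `2` the conclusion of `hW` is the
tree's THEOREM `exists_ordinary_newform_lift_of_weightOne_of_isUnramifiedAt`
(`Automorphic/WeightOneOrdinaryLiftGaloisProofs`: `2 ∤ N₁` by Deligne–Serre Thm. 4.6 (a); the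
`2`-stabilisation `f₁(τ) - β f₁(2τ)` is a `U₂`-eigenform with unit eigenvalue; multiplied by a
level-one Eisenstein series `≡ 1 (mod 2)` it is an eigenform modulo `𝔪` of weight `≥ 5`; the
Deligne–Serre lifting lemma with `U₂` and the diamond operators in the family, Atkin–Lehner–Li, and
Chebotarev–Brauer–Nesbitt give a `2`-ordinary newform `g` of weight `≥ 2` with `ρ̄_g ≅ τ`), with the
trivial twist `θ = 1`.  In Allen's proof (p. 70) both cases are covered at once by
[WilesOrdinary, Theorem 3], whose `Λ`-adic theory allows level divisible by `p`.
[cite: Allen2014, Lemma 87 (arXiv:1301.1113v2, §5.1.1, p. 70)] [cite: Wiles1988, Thm. 3]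
[cite: DeligneSerreASENS1974, 6.9–6.11 and Thm. 4.6 (a)] -/
theorem heckeWilesLift_of_langlands_tunnell_of_hida326_of_ramifiedWilesLift
    (hLT : ∀ σ, langlands_tunnell σ)
    (hH : Literature.NumberTheory.EllipticCurves.Hida2000_thm326_exists_galoisRep)
    (hWram : ∀ (N₁ : ℕ) [NeZero N₁] (f₁ : CuspForm (Gamma1 N₁) 1)
      (ι₁ : coeffCharField f₁ →+* PadicAlgCl 2) (ρ₁ : FramedGaloisRep ℚ (PadicAlgCl 2) 2)
      (τ : absoluteGaloisGroup ℚ →* GL (Fin 2) (padicAlgClResidueField 2)),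
      IsNewform1 f₁ → IsGaloisRepOfNewform1 f₁ ι₁ {q | q ∣ N₁} ρ₁ →
      IsOpen ((ρ₁ : absoluteGaloisGroup ℚ →* GL (Fin 2) (PadicAlgCl 2)).ker :
        Set (absoluteGaloisGroup ℚ)) →
      ¬ HasCommonEigenvector τ → ρ₁.IsReductionOf (RingHom.id _) τ →
      (∃ v : HeightOneSpectrum (𝓞 ℚ), ((2 : ℕ) : 𝓞 ℚ) ∈ v.asIdeal ∧ ¬ ρ₁.IsUnramifiedAt v ∧
        ∃ (P : GL (Fin 2) (PadicAlgCl 2))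
          (χ₁ χ₂ : absoluteGaloisGroup (v.adicCompletion ℚ) →* padicAlgClIntegers 2) (n : ℕ),
          0 < n ∧
          (∀ σ, (P⁻¹ * ρ₁.toLocal v σ * P).val =
            Matrix.diagonal ![(χ₁ σ : PadicAlgCl 2), (χ₂ σ : PadicAlgCl 2)]) ∧
          (∀ σ, (χ₁ σ : PadicAlgCl 2) ^ n = 1 ∧ (χ₂ σ : PadicAlgCl 2) ^ n = 1) ∧
          Continuous (fun σ => (χ₁ σ : PadicAlgCl 2)) ∧
          Continuous (fun σ => (χ₂ σ : PadicAlgCl 2))) →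
      ∃ (N₀ : ℕ) (_ : NeZero N₀) (k₀ : ℤ) (g : CuspForm (Gamma1 N₀) k₀)
        (ιg : coeffCharField g →+* PadicAlgCl 2) (ρg : FramedGaloisRep ℚ (PadicAlgCl 2) 2)
        (θ : absoluteGaloisGroup ℚ →ₜ* (PadicAlgCl 2)ˣ),
        2 ≤ k₀ ∧ IsNewform1 g ∧
        ‖ιg ⟨(UpperHalfPlane.qExpansion 1 ⇑g).coeff 2, cuspCoeff_mem_coeffCharField g 2⟩‖ = 1 ∧
        IsGaloisRepOfNewform1 g ιg {q | q ∣ N₀ * 2} ρg ∧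
        (∃ n : ℕ, 0 < n ∧ ∀ σ, θ σ ^ n = 1) ∧
        FramedGaloisRep.IsResidualRepOf (FramedRep.twist ρg θ) (RingHom.id _) τ) :
    ∀ (ρ₁ : FramedGaloisRep ℚ (PadicAlgCl 2) 2)
      (ρ₀' : absoluteGaloisGroup ℚ →* GL (Fin 2) (padicAlgClIntegers 2))
      (Hm : Subgroup (absoluteGaloisGroup ℚ))
      (τ : absoluteGaloisGroup ℚ →* GL (Fin 2) (padicAlgClResidueField 2)),
      (∀ σ, Matrix.GeneralLinearGroup.map (padicAlgClIntegers 2).subtype (ρ₀' σ) = ρ₁ σ) →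
      IsOpen ((ρ₁ : absoluteGaloisGroup ℚ →* GL (Fin 2) (PadicAlgCl 2)).ker :
        Set (absoluteGaloisGroup ℚ)) →
      IsOpen (Hm : Set (absoluteGaloisGroup ℚ)) → Hm.index = 2 →
      (∀ h ∈ Hm, (ρ₀' h).val 0 1 = 0 ∧ (ρ₀' h).val 1 0 = 0) →
      (∀ g ∉ Hm, (ρ₀' g).val 0 0 = 0 ∧ (ρ₀' g).val 1 1 = 0) →
      ρ₁.IsOdd → ¬ HasCommonEigenvector τ → ρ₁.IsReductionOf (RingHom.id _) τ →
      (∃ v : HeightOneSpectrum (𝓞 ℚ), ((2 : ℕ) : 𝓞 ℚ) ∈ v.asIdeal ∧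
        ∃ (P : GL (Fin 2) (PadicAlgCl 2))
          (χ₁ χ₂ : absoluteGaloisGroup (v.adicCompletion ℚ) →* padicAlgClIntegers 2) (n : ℕ),
          0 < n ∧
          (∀ σ, (P⁻¹ * ρ₁.toLocal v σ * P).val =
            Matrix.diagonal ![(χ₁ σ : PadicAlgCl 2), (χ₂ σ : PadicAlgCl 2)]) ∧
          (∀ σ, (χ₁ σ : PadicAlgCl 2) ^ n = 1 ∧ (χ₂ σ : PadicAlgCl 2) ^ n = 1) ∧
          Continuous (fun σ => (χ₁ σ : PadicAlgCl 2)) ∧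
          Continuous (fun σ => (χ₂ σ : PadicAlgCl 2))) →
      ∃ (N₀ : ℕ) (_ : NeZero N₀) (k₀ : ℤ) (g : CuspForm (Gamma1 N₀) k₀)
        (ιg : coeffCharField g →+* PadicAlgCl 2) (ρg : FramedGaloisRep ℚ (PadicAlgCl 2) 2)
        (θ : absoluteGaloisGroup ℚ →ₜ* (PadicAlgCl 2)ˣ),
        2 ≤ k₀ ∧ IsNewform1 g ∧
        ‖ιg ⟨(UpperHalfPlane.qExpansion 1 ⇑g).coeff 2, cuspCoeff_mem_coeffCharField g 2⟩‖ = 1 ∧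
        IsGaloisRepOfNewform1 g ιg {q | q ∣ N₀ * 2} ρg ∧
        (∃ n : ℕ, 0 < n ∧ ∀ σ, θ σ ^ n = 1) ∧
        FramedGaloisRep.IsResidualRepOf (FramedRep.twist ρg θ) (RingHom.id _) τ := by
  intro ρ₁ ρ₀' Hm τ hmap hopen _ hHi hdg _ hodd hce hred hloc
  -- (Hecke / Langlands–Tunnell): the weight-one newform of the odd monomial lift `ρ₁`
  obtain ⟨N₁, hN₁, f₁, ι₁, hf₁, hρ₁⟩ :=
    exists_weightOne_newform_of_isReductionOf_of_monomial hLT ρ₁ ρ₀' hmap hopen Hm hHi hdg hodd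
      hred hce
  obtain ⟨v, hv, P, χ₁, χ₂, n, hn, h1, h2, h3, h4⟩ := hloc
  by_cases hunr : ρ₁.IsUnramifiedAt v
  · -- `ρ₁` unramified at `2`: the classical ordinary lift (PROVED), trivial twist
    obtain ⟨N₀, hN₀, k₀, g, ιg, ρg, hk₀, hg, hord, hρg, hres⟩ :=
      exists_ordinary_newform_lift_of_weightOne_of_isUnramifiedAt hH f₁ ι₁ ρ₁ τ hf₁ hρ₁ hopen hce
        hred hv hunr
    refine ⟨N₀, hN₀, k₀, g, ιg, ρg, 1, hk₀, hg, hord, hρg, ⟨1, one_pos, fun σ ↦ ?_⟩, ?_⟩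
    · rw [pow_one]; rfl
    · rw [FramedRep.twist_one]
      exact hres
  · -- `ρ₁` ramified at `2`: Wiles 1988, Thm. 3 (hypothesis)
    exact hWram N₁ f₁ ι₁ ρ₁ τ hf₁ hρ₁ hopen hce hred ⟨v, hv, hunr, P, χ₁, χ₂, n, hn, h1, h2, h3, h4⟩

/-- **Allen 2014, Theorem of the Introduction for `F = ℚ`, from Theorem 93 (finalthm),
Langlands–Tunnell, Hida 2000 Thm. 3.26 (1), and Wiles's ordinary families for RAMIFIED weight-one
forms only** — the refinement of
`Allen2014_modularity_nearlyOrdinaryDihedral_Q_of_finalthm_of_langlandsTunnell_of_wilesLift` in which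
the case "`ρ₁` unramified at `2`" of Wiles's input (hypothesis `hW` there) is no longer assumed but
PROVED (`heckeWilesLift_of_langlands_tunnell_of_hida326_of_ramifiedWilesLift`).  After this, the
inputs of the named fact `Allen2014_modularity_nearlyOrdinaryDihedral_Q` that are NOT theorems of the
tree are exactly: `h93` (Allen's Theorem 93 for `F = ℚ`), `hLT` (`∀ σ, langlands_tunnell σ`, an
existing tracked fact), `hH` (`Hida2000_thm326_exists_galoisRep`, an existing tracked fact, reduced
in the tree to Deligne–Serre Thm. 6.1) and `hWram` (Wiles 1988, Thm. 3 with classicality, for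
weight-one newforms whose `2`-adic representation is ramified at `2` — in Allen's setting: `2`
ramified in the quadratic field from which `ρ̄` is induced).  Nothing here claims any of them.
[cite: Allen2014, Theorem 93 (arXiv:1301.1113v2, §5.2, pp. 75–77), Lemma 87 (§5.1.1, pp. 69–70) and p. 77 l. 10] -/
theorem Allen2014_modularity_nearlyOrdinaryDihedral_Q_of_finalthm_of_langlandsTunnell_of_hida326_of_ramifiedWilesLift
    (h93 : ∀ (ρ : FramedGaloisRep ℚ (PadicAlgCl 2) 2),
      (∀ᶠ v : HeightOneSpectrum (𝓞 ℚ) in cofinite, ρ.IsUnramifiedAt v) →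
      (∃ (χ₀ : absoluteGaloisGroup ℚ →ₜ* (PadicAlgCl 2)ˣ) (a : ℤ) (k m : ℕ),
        (∀ σ, χ₀ σ = cyclotomicPadicAlgCl ℚ 2 σ ^ a) ∧ 2 ≤ k ∧ 0 < m ∧
        (∀ v : HeightOneSpectrum (𝓞 ℚ), ((2 : ℕ) : 𝓞 ℚ) ∈ v.asIdeal →
          FramedGaloisRep.IsOrdinaryOfWeightAt 2 (FramedRep.twist ρ χ₀) v k m) ∧
        ∃ n : ℕ, 0 < n ∧ ∀ σ,
          (FramedRep.det (FramedRep.twist ρ χ₀) σ *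
            (cyclotomicPadicAlgCl ℚ 2 σ ^ ((k : ℤ) - 1))⁻¹) ^ n = 1) →
      ρ.IsOdd →
      ρ.IsResiduallyAbsIrreducible →
      (∀ L : IntermediateField ℚ (AlgebraicClosure ℚ), Module.finrank ℚ L = 2 →
        (∀ σ ∈ (L.fixingSubgroup : Subgroup (absoluteGaloisGroup ℚ)),
          ∀ τ ∈ (L.fixingSubgroup : Subgroup (absoluteGaloisGroup ℚ)),
            Commute (ρ.residualRep σ) (ρ.residualRep τ)) →
        IsTotallyComplex L →
          ∃ v : HeightOneSpectrum (𝓞 ℚ), ((2 : ℕ) : 𝓞 ℚ) ∈ v.asIdeal ∧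
            (v.asIdeal.primesOver (𝓞 L)).Subsingleton) →
      (∃ (N₀ : ℕ) (_ : NeZero N₀) (k₀ : ℤ) (g : CuspForm (Gamma1 N₀) k₀)
        (ιg : coeffCharField g →+* PadicAlgCl 2) (ρg : FramedGaloisRep ℚ (PadicAlgCl 2) 2)
        (θ : absoluteGaloisGroup ℚ →ₜ* (PadicAlgCl 2)ˣ),
        2 ≤ k₀ ∧ IsNewform1 g ∧
        ‖ιg ⟨(UpperHalfPlane.qExpansion 1 ⇑g).coeff 2, cuspCoeff_mem_coeffCharField g 2⟩‖ = 1 ∧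
        IsGaloisRepOfNewform1 g ιg {q | q ∣ N₀ * 2} ρg ∧
        (∃ n : ℕ, 0 < n ∧ ∀ σ, θ σ ^ n = 1) ∧
        FramedGaloisRep.IsResidualRepOf (FramedRep.twist ρg θ) (RingHom.id _) ρ.residualRep) →
      ∃ (χ : absoluteGaloisGroup ℚ →ₜ* (PadicAlgCl 2)ˣ) (m : ℤ),
        (∀ σ, χ σ = cyclotomicPadicAlgCl ℚ 2 σ ^ m) ∧
        ∃ (N : ℕ) (_ : NeZero N) (k : ℤ) (f : CuspForm (Gamma1 N) k)
          (ιf : coeffCharField f →+* PadicAlgCl 2),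
          IsNewform1 f ∧ IsGaloisRepOfNewform1 f ιf {q | q ∣ N * 2} (FramedRep.twist ρ χ))
    (hLT : ∀ σ, langlands_tunnell σ)
    (hH : Literature.NumberTheory.EllipticCurves.Hida2000_thm326_exists_galoisRep)
    (hWram : ∀ (N₁ : ℕ) [NeZero N₁] (f₁ : CuspForm (Gamma1 N₁) 1)
      (ι₁ : coeffCharField f₁ →+* PadicAlgCl 2) (ρ₁ : FramedGaloisRep ℚ (PadicAlgCl 2) 2)
      (τ : absoluteGaloisGroup ℚ →* GL (Fin 2) (padicAlgClResidueField 2)),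
      IsNewform1 f₁ → IsGaloisRepOfNewform1 f₁ ι₁ {q | q ∣ N₁} ρ₁ →
      IsOpen ((ρ₁ : absoluteGaloisGroup ℚ →* GL (Fin 2) (PadicAlgCl 2)).ker :
        Set (absoluteGaloisGroup ℚ)) →
      ¬ HasCommonEigenvector τ → ρ₁.IsReductionOf (RingHom.id _) τ →
      (∃ v : HeightOneSpectrum (𝓞 ℚ), ((2 : ℕ) : 𝓞 ℚ) ∈ v.asIdeal ∧ ¬ ρ₁.IsUnramifiedAt v ∧
        ∃ (P : GL (Fin 2) (PadicAlgCl 2))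
          (χ₁ χ₂ : absoluteGaloisGroup (v.adicCompletion ℚ) →* padicAlgClIntegers 2) (n : ℕ),
          0 < n ∧
          (∀ σ, (P⁻¹ * ρ₁.toLocal v σ * P).val =
            Matrix.diagonal ![(χ₁ σ : PadicAlgCl 2), (χ₂ σ : PadicAlgCl 2)]) ∧
          (∀ σ, (χ₁ σ : PadicAlgCl 2) ^ n = 1 ∧ (χ₂ σ : PadicAlgCl 2) ^ n = 1) ∧
          Continuous (fun σ => (χ₁ σ : PadicAlgCl 2)) ∧
          Continuous (fun σ => (χ₂ σ : PadicAlgCl 2))) →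
      ∃ (N₀ : ℕ) (_ : NeZero N₀) (k₀ : ℤ) (g : CuspForm (Gamma1 N₀) k₀)
        (ιg : coeffCharField g →+* PadicAlgCl 2) (ρg : FramedGaloisRep ℚ (PadicAlgCl 2) 2)
        (θ : absoluteGaloisGroup ℚ →ₜ* (PadicAlgCl 2)ˣ),
        2 ≤ k₀ ∧ IsNewform1 g ∧
        ‖ιg ⟨(UpperHalfPlane.qExpansion 1 ⇑g).coeff 2, cuspCoeff_mem_coeffCharField g 2⟩‖ = 1 ∧
        IsGaloisRepOfNewform1 g ιg {q | q ∣ N₀ * 2} ρg ∧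
        (∃ n : ℕ, 0 < n ∧ ∀ σ, θ σ ^ n = 1) ∧
        FramedGaloisRep.IsResidualRepOf (FramedRep.twist ρg θ) (RingHom.id _) τ) :
    Allen2014_modularity_nearlyOrdinaryDihedral_Q :=
  Allen2014_modularity_nearlyOrdinaryDihedral_Q_of_finalthm_of_heckeWilesLift h93
    (heckeWilesLift_of_langlands_tunnell_of_hida326_of_ramifiedWilesLift hLT hH hWram)

end ArchitectureClassicalLift

/-! ### The automorphic half WITHOUT Wiles's input: `hHW` from Langlands–Tunnell and Hida 3.26 alone -/

section ArchitectureNoWiles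

set_option maxHeartbeats 1600000 in
/-- **Lemma 87 over `ℚ`, automorphic half, with NO input from Wiles 1988**: `hHW` follows from
Langlands–Tunnell (`hLT`) and Deligne's `2`-adic representation of a newform of weight `≥ 2`
through a prescribed embedding (`hH : Hida2000_thm326_exists_galoisRep`, an EXISTING named fact)
alone.  Given the odd monomial Artin lift `ρ₁` of `τ = ρ̄` with local shape
`ρ₁|_{Γ_{ℚ_v}} ≅ χ₁ ⊕ χ₂` (`v ∣ 2`, `χᵢ` continuous of finite order):
(1) globalise `χ₂|_{I}` to a continuous finite-order `θ : Γ_ℚ → ℚ̄₂ˣ` of `2`-power order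
(`adicCompletion_rat_exists_continuousMonoidHom_apply_absGaloisRestrict_eq`, local Kronecker–Weber);
`θ` is RESIDUALLY TRIVIAL (`2`-power roots of unity reduce to `1` in characteristic `2`), so
`ρ₁' := ρ₁ ⊗ θ⁻¹` still reduces to `τ` (`isReductionOf_twist_iff`) and still satisfies the
Langlands–Tunnell hypotheses (`FiniteOrderTwistLanglandsTunnellInputs`), whence a weight-one
newform `f₁'` with `ρ_{f₁'} ≅ ρ₁'`; (2) `ρ₁'|_{Γ_{ℚ_v}} ≅ χ₁θ⁻¹ ⊕ χ₂θ⁻¹` with `χ₂θ⁻¹` unramified: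
if `χ₁ = χ₂` on inertia, `ρ₁'` is unramified at `2` and
`exists_ordinary_newform_lift_of_weightOne_of_isUnramifiedAt` applies; otherwise `ρ₁'` is
ramified at `2` with a one-dimensional unramified quotient, so `2 ∣ N(f₁')`, `a₂(f₁')` is a
`2`-adic unit (Deligne–Serre Thm. 4.6 (b), `norm_cuspCoeff_eq_one_of_toLocal_diagonal`) and
`exists_ordinary_newform_lift_of_weightOne_of_dvd_level` applies.  In both cases the lift `g` is a
`2`-ordinary newform of weight `≥ 2` whose `ρ_g` has residual representation `τ` (trivial twist
`θ = 1` in the conclusion).  In Allen's text (p. 70) all of this is "[WilesOrdinary, Theorem 3]".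
[cite: Allen2014, Lemma 87 (arXiv:1301.1113v2, §5.1.1, p. 70)] [cite: DeligneSerreASENS1974, 6.9–6.11 and Thm. 4.6]
[cite: Wiles1988, §1] -/
theorem heckeWilesLift_of_langlands_tunnell_of_hida326
    (hLT : ∀ σ, langlands_tunnell σ)
    (hH : Literature.NumberTheory.EllipticCurves.Hida2000_thm326_exists_galoisRep) :
    ∀ (ρ₁ : FramedGaloisRep ℚ (PadicAlgCl 2) 2)
      (ρ₀' : absoluteGaloisGroup ℚ →* GL (Fin 2) (padicAlgClIntegers 2))
      (Hm : Subgroup (absoluteGaloisGroup ℚ))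
      (τ : absoluteGaloisGroup ℚ →* GL (Fin 2) (padicAlgClResidueField 2)),
      (∀ σ, Matrix.GeneralLinearGroup.map (padicAlgClIntegers 2).subtype (ρ₀' σ) = ρ₁ σ) →
      IsOpen ((ρ₁ : absoluteGaloisGroup ℚ →* GL (Fin 2) (PadicAlgCl 2)).ker :
        Set (absoluteGaloisGroup ℚ)) →
      IsOpen (Hm : Set (absoluteGaloisGroup ℚ)) → Hm.index = 2 →
      (∀ h ∈ Hm, (ρ₀' h).val 0 1 = 0 ∧ (ρ₀' h).val 1 0 = 0) →
      (∀ g ∉ Hm, (ρ₀' g).val 0 0 = 0 ∧ (ρ₀' g).val 1 1 = 0) →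
      ρ₁.IsOdd → ¬ HasCommonEigenvector τ → ρ₁.IsReductionOf (RingHom.id _) τ →
      (∃ v : HeightOneSpectrum (𝓞 ℚ), ((2 : ℕ) : 𝓞 ℚ) ∈ v.asIdeal ∧
        ∃ (P : GL (Fin 2) (PadicAlgCl 2))
          (χ₁ χ₂ : absoluteGaloisGroup (v.adicCompletion ℚ) →* padicAlgClIntegers 2) (n : ℕ),
          0 < n ∧
          (∀ σ, (P⁻¹ * ρ₁.toLocal v σ * P).val =
            Matrix.diagonal ![(χ₁ σ : PadicAlgCl 2), (χ₂ σ : PadicAlgCl 2)]) ∧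
          (∀ σ, (χ₁ σ : PadicAlgCl 2) ^ n = 1 ∧ (χ₂ σ : PadicAlgCl 2) ^ n = 1) ∧
          Continuous (fun σ => (χ₁ σ : PadicAlgCl 2)) ∧
          Continuous (fun σ => (χ₂ σ : PadicAlgCl 2))) →
      ∃ (N₀ : ℕ) (_ : NeZero N₀) (k₀ : ℤ) (g : CuspForm (Gamma1 N₀) k₀)
        (ιg : coeffCharField g →+* PadicAlgCl 2) (ρg : FramedGaloisRep ℚ (PadicAlgCl 2) 2)
        (θ : absoluteGaloisGroup ℚ →ₜ* (PadicAlgCl 2)ˣ),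
        2 ≤ k₀ ∧ IsNewform1 g ∧
        ‖ιg ⟨(UpperHalfPlane.qExpansion 1 ⇑g).coeff 2, cuspCoeff_mem_coeffCharField g 2⟩‖ = 1 ∧
        IsGaloisRepOfNewform1 g ιg {q | q ∣ N₀ * 2} ρg ∧
        (∃ n : ℕ, 0 < n ∧ ∀ σ, θ σ ^ n = 1) ∧
        FramedGaloisRep.IsResidualRepOf (FramedRep.twist ρg θ) (RingHom.id _) τ := by
  intro ρ₁ ρ₀' Hm τ hmap hopen _ hHi hdg _ hodd hce hred hloc
  obtain ⟨v, hv, P, χ₁, χ₂, n, hn, hdiag, hpow, -, hc₂⟩ := hloc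
  have hp : Nat.Prime 2 := Nat.prime_two
  -- `Γ_ℚ`-level consequences of the monomial structure
  have hce₁ : ¬ HasCommonEigenvector (ρ₁ : absoluteGaloisGroup ℚ →* GL (Fin 2) (PadicAlgCl 2)) :=
    ρ₁.not_hasCommonEigenvector_of_isReductionOf hred hce
  have hsolv₁ : IsSolvable (ρ₁ : absoluteGaloisGroup ℚ →* GL (Fin 2) (PadicAlgCl 2)).range :=
    isSolvable_range_of_monomial_map (padicAlgClIntegers 2).subtype ρ₀' _ hmap Hm hHi hdg
  -- ### (1) the global character `θ` with `θ ∘ res = χ₂` on the inertia group, and `ρ₁' = ρ₁ ⊗ θ⁻¹`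
  have hPv : ((Rat.HeightOneSpectrum.primesEquiv v : Nat.Primes) : ℕ) = 2 := by
    have hdvd : Rat.HeightOneSpectrum.natGenerator v ∣ 2 :=
      (Rat.natCast_mem_asIdeal_iff (v := v)).mp hv
    exact (Nat.prime_dvd_prime_iff_eq (Rat.HeightOneSpectrum.primesEquiv v).2 hp).mp hdvd
  obtain ⟨m, θ, -, hθpow, hθopen, hθI⟩ :=
    adicCompletion_rat_exists_continuousMonoidHom_apply_absGaloisRestrict_eq 2 v hPv χ₂ hn
      (fun σ ↦ (hpow σ).2) hc₂
  have hθpow' : ∀ σ, θ σ ^ 2 ^ (m - 1) = 1 := fun σ ↦ by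
    have h := hθpow σ
    rwa [show (2 : ℕ) - 1 = 1 from rfl, mul_one] at h
  have hθinv : ∀ σ, (θ⁻¹ : absoluteGaloisGroup ℚ →ₜ* (PadicAlgCl 2)ˣ) σ = (θ σ)⁻¹ := fun σ ↦ rfl
  -- `θ⁻¹` is residually trivial
  have hθres : ∀ σ, ∃ u : padicAlgClIntegers 2,
      (u : PadicAlgCl 2) = (((θ⁻¹ : absoluteGaloisGroup ℚ →ₜ* (PadicAlgCl 2)ˣ) σ : (PadicAlgCl 2)ˣ) :
        PadicAlgCl 2) ∧ IsLocalRing.residue (padicAlgClIntegers 2) u = 1 := by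
    intro σ
    refine PadicAlgCl.exists_residue_eq_one_of_pow_two_pow_eq_one (r := m - 1) ?_
    rw [hθinv, ← Units.val_pow_eq_pow_val, inv_pow, hθpow' σ, inv_one, Units.val_one]
  set ρ₁' : FramedGaloisRep ℚ (PadicAlgCl 2) 2 := FramedRep.twist ρ₁ θ⁻¹ with hρ₁'
  -- the Langlands–Tunnell hypotheses for `ρ₁'`, and its weight-one newform `f₁'`
  have hopenθ : IsOpen (((θ⁻¹ : absoluteGaloisGroup ℚ →ₜ* (PadicAlgCl 2)ˣ) :
      absoluteGaloisGroup ℚ →* (PadicAlgCl 2)ˣ).ker : Set (absoluteGaloisGroup ℚ)) := by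
    convert hθopen using 1
    ext σ
    simp only [SetLike.mem_coe, MonoidHom.mem_ker]
    change (θ⁻¹ : absoluteGaloisGroup ℚ →ₜ* (PadicAlgCl 2)ˣ) σ = 1 ↔ θ σ = 1
    rw [hθinv, inv_eq_one]
  have hopen' : IsOpen ((ρ₁' : absoluteGaloisGroup ℚ →* GL (Fin 2) (PadicAlgCl 2)).ker :
      Set (absoluteGaloisGroup ℚ)) :=
    FramedRep.isOpen_ker_twist ρ₁ θ⁻¹ hopen hopenθ
  have hce₁' : ¬ HasCommonEigenvector (ρ₁' : absoluteGaloisGroup ℚ →* GL (Fin 2) (PadicAlgCl 2)) :=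
    not_hasCommonEigenvector_twist ρ₁ θ⁻¹ hce₁
  have hodd' : ρ₁'.IsOdd := FramedGaloisRep.isOdd_twist ρ₁ θ⁻¹ hodd
  have hsolv' : IsSolvable (ρ₁' : absoluteGaloisGroup ℚ →* GL (Fin 2) (PadicAlgCl 2)).range :=
    FramedRep.isSolvable_range_twist ρ₁ θ⁻¹ hsolv₁
  obtain ⟨N₁, hN₁, f₁, ι₁, hf₁, hρf₁⟩ :=
    exists_weightOne_newform_of_langlands_tunnell hLT ρ₁' hopen' hce₁' hodd' hsolv'
  -- `ρ₁'` still reduces to `τ`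
  have hred' : ρ₁'.IsReductionOf (RingHom.id _) τ :=
    (GaloisRepresentations.isReductionOf_twist_iff (k := padicAlgClResidueField 2) hθres).2 hred
  -- ### (2) the local shape of `ρ₁'`: `diag(χ₁ θ⁻¹, χ₂ θ⁻¹)` with the second entry unramified
  set ψ₁ : absoluteGaloisGroup (v.adicCompletion ℚ) → PadicAlgCl 2 := fun σ ↦
    (((θ⁻¹ : absoluteGaloisGroup ℚ →ₜ* (PadicAlgCl 2)ˣ) (absGaloisRestrict ℚ (v.adicCompletion ℚ) σ) :
      (PadicAlgCl 2)ˣ) : PadicAlgCl 2) * (χ₁ σ : PadicAlgCl 2) with hψ₁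
  set ψ₂ : absoluteGaloisGroup (v.adicCompletion ℚ) → PadicAlgCl 2 := fun σ ↦
    (((θ⁻¹ : absoluteGaloisGroup ℚ →ₜ* (PadicAlgCl 2)ˣ) (absGaloisRestrict ℚ (v.adicCompletion ℚ) σ) :
      (PadicAlgCl 2)ˣ) : PadicAlgCl 2) * (χ₂ σ : PadicAlgCl 2) with hψ₂
  have htw : ∀ σ, ρ₁'.toLocal v σ =
      ((ρ₁.toLocal v).twist ((θ⁻¹ : absoluteGaloisGroup ℚ →ₜ* (PadicAlgCl 2)ˣ).comp
        (absGaloisRestrict ℚ (v.adicCompletion ℚ)))) σ := fun σ ↦ rfl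
  have hdiag' : ∀ σ, ((P⁻¹ * ρ₁'.toLocal v σ * P : GL (Fin 2) (PadicAlgCl 2)) :
      Matrix (Fin 2) (Fin 2) (PadicAlgCl 2)) = Matrix.diagonal ![ψ₁ σ, ψ₂ σ] := fun σ ↦ by
    rw [htw σ]
    exact FramedRep.coe_conj_twist_of_diagonal (hdiag σ) _
  have hχ₂ne : ∀ σ, (χ₂ σ : PadicAlgCl 2) ≠ 0 := fun σ h0 ↦ by
    have h := (hpow σ).2
    rw [h0, zero_pow hn.ne'] at h
    exact zero_ne_one h
  have hψ₂I : ∀ i ∈ absInertia (v.adicCompletion ℚ), ψ₂ i = 1 := fun i hi ↦ by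
    rw [hψ₂]
    change (((θ⁻¹ : absoluteGaloisGroup ℚ →ₜ* (PadicAlgCl 2)ˣ) (absGaloisRestrict ℚ (v.adicCompletion ℚ) i) :
      (PadicAlgCl 2)ˣ) : PadicAlgCl 2) * (χ₂ i : PadicAlgCl 2) = 1
    rw [hθinv, Units.val_inv_eq_inv_val, hθI i hi, inv_mul_cancel₀ (hχ₂ne i)]
  have hψ₁I : ∀ i ∈ absInertia (v.adicCompletion ℚ),
      ψ₁ i = (χ₂ i : PadicAlgCl 2)⁻¹ * (χ₁ i : PadicAlgCl 2) := fun i hi ↦ by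
    rw [hψ₁]
    change (((θ⁻¹ : absoluteGaloisGroup ℚ →ₜ* (PadicAlgCl 2)ˣ) (absGaloisRestrict ℚ (v.adicCompletion ℚ) i) :
      (PadicAlgCl 2)ˣ) : PadicAlgCl 2) * (χ₁ i : PadicAlgCl 2) = _
    rw [hθinv, Units.val_inv_eq_inv_val, hθI i hi]
  by_cases hI : ∀ i ∈ absInertia (v.adicCompletion ℚ), (χ₁ i : PadicAlgCl 2) = χ₂ i
  · -- ### case: `χ₁ = χ₂` on inertia — `ρ₁'` is unramified at `2`
    have hunr' : ρ₁'.IsUnramifiedAt v := by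
      refine FramedGaloisRep.isUnramifiedAt_of_forall_toLocal_eq_one v ρ₁' fun i hi ↦ ?_
      refine GeneralLinearGroup.eq_one_of_coe_conj_eq_one (P := P) ?_
      rw [hdiag' i, hψ₂I i hi, hψ₁I i hi, hI i hi, inv_mul_cancel₀ (hχ₂ne i)]
      ext a b
      fin_cases a <;> fin_cases b <;> simp
    obtain ⟨N₀, hN₀, k₀, g, ιg, ρg, hk₀, hg, hord, hρg, hres⟩ :=
      exists_ordinary_newform_lift_of_weightOne_of_isUnramifiedAt hH f₁ ι₁ ρ₁' τ hf₁ hρf₁ hopen'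
        hce hred' hv hunr'
    refine ⟨N₀, hN₀, k₀, g, ιg, ρg, 1, hk₀, hg, hord, hρg, ⟨1, one_pos, fun σ ↦ ?_⟩, ?_⟩
    · rw [pow_one]; rfl
    · rw [FramedRep.twist_one]
      exact hres
  · -- ### case: `χ₁ ≠ χ₂` on inertia — `ρ₁'` is ramified at `2` with unramified quotient `χ₂ θ⁻¹`
    push Not at hI
    obtain ⟨i₀, hi₀, hne⟩ := hI
    have hψ₁ne : ∃ i ∈ absInertia (v.adicCompletion ℚ), ψ₁ i ≠ 1 := by
      refine ⟨i₀, hi₀, fun h1 ↦ hne ?_⟩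
      rw [hψ₁I i₀ hi₀] at h1
      have h2 := congrArg (fun x ↦ (χ₂ i₀ : PadicAlgCl 2) * x) h1
      simp only [← mul_assoc, mul_inv_cancel₀ (hχ₂ne i₀), one_mul, mul_one] at h2
      exact h2
    -- `ρ₁'` is ramified at `v`, so `2 ∣ N₁`
    have hram : ¬ ρ₁'.IsUnramifiedAt v := by
      intro hunr
      obtain ⟨i, hi, hne1⟩ := hψ₁ne
      have h1 := FramedGaloisRep.toLocal_eq_one_of_isUnramifiedAt v ρ₁' hunr hi
      have h2 := hdiag' i
      rw [h1, mul_one, inv_mul_cancel, Units.val_one] at h2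
      have h3 := congrFun (congrFun h2 0) 0
      simp at h3
      exact hne1 h3.symm
    have h2N₁ : 2 ∣ N₁ := by
      by_contra h2N
      exact hram (hρf₁ v (by rw [Set.mem_setOf_eq, hPv]; exact h2N)).1
    -- `a₂(f₁)` is a `2`-adic unit (Deligne–Serre Thm. 4.6 (b))
    have hψ₂pow : ∀ σ, ψ₂ σ ^ (2 ^ (m - 1) * n) = 1 := fun σ ↦ by
      rw [hψ₂]
      change ((((θ⁻¹ : absoluteGaloisGroup ℚ →ₜ* (PadicAlgCl 2)ˣ) (absGaloisRestrict ℚ (v.adicCompletion ℚ) σ) :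
        (PadicAlgCl 2)ˣ) : PadicAlgCl 2) * (χ₂ σ : PadicAlgCl 2)) ^ (2 ^ (m - 1) * n) = 1
      rw [mul_pow, pow_mul, ← Units.val_pow_eq_pow_val, hθinv, inv_pow, hθpow', inv_one,
        Units.val_one, one_pow, one_mul, mul_comm, pow_mul, (hpow σ).2, one_pow]
    have hunit : ‖ι₁ ⟨(UpperHalfPlane.qExpansion 1 ⇑f₁).coeff 2, cuspCoeff_mem_coeffCharField f₁ 2⟩‖ = 1 :=
      norm_cuspCoeff_eq_one_of_toLocal_diagonal f₁ ι₁ ρ₁' hf₁ hρf₁ hopen' hv h2N₁ P ψ₁ ψ₂ hdiag'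
        hψ₂I hψ₁ne (Nat.mul_pos (Nat.pow_pos two_pos) hn) hψ₂pow
    obtain ⟨N₀, hN₀, k₀, g, ιg, ρg, hk₀, hg, hord, hρg, hres⟩ :=
      exists_ordinary_newform_lift_of_weightOne_of_dvd_level hH f₁ ι₁ ρ₁' τ hf₁ hρf₁ hce hred'
        h2N₁ hunit
    refine ⟨N₀, hN₀, k₀, g, ιg, ρg, 1, hk₀, hg, hord, hρg, ⟨1, one_pos, fun σ ↦ ?_⟩, ?_⟩
    · rw [pow_one]; rfl
    · rw [FramedRep.twist_one]
      exact hres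

/-- **Allen 2014, Theorem of the Introduction for `F = ℚ`, from Theorem 93 (finalthm),
Langlands–Tunnell and Hida 2000 Thm. 3.26 (1) ONLY** — the refinement of
`Allen2014_modularity_nearlyOrdinaryDihedral_Q_of_finalthm_of_langlandsTunnell_of_hida326_of_ramifiedWilesLift`
in which Wiles's input is no longer assumed in any case (`heckeWilesLift_of_langlands_tunnell_of_hida326`).
After this, the inputs of the named fact `Allen2014_modularity_nearlyOrdinaryDihedral_Q` that are
NOT theorems of the tree are exactly: `h93` (Allen's Theorem 93 for `F = ℚ`: the `R^red = T`
theorem over a solvable totally real `F′` and soluble descent), `hLT` (`∀ σ, langlands_tunnell σ`,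
an existing tracked fact) and `hH` (`Hida2000_thm326_exists_galoisRep`, an existing tracked fact,
reduced in the tree to Deligne–Serre Thm. 6.1).  Nothing here claims any of them.
[cite: Allen2014, Theorem 93 (arXiv:1301.1113v2, §5.2, pp. 75–77), Lemma 87 (§5.1.1, pp. 69–70) and p. 77 l. 10] -/
theorem Allen2014_modularity_nearlyOrdinaryDihedral_Q_of_finalthm_of_langlandsTunnell_of_hida326
    (h93 : ∀ (ρ : FramedGaloisRep ℚ (PadicAlgCl 2) 2),
      (∀ᶠ v : HeightOneSpectrum (𝓞 ℚ) in cofinite, ρ.IsUnramifiedAt v) →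
      (∃ (χ₀ : absoluteGaloisGroup ℚ →ₜ* (PadicAlgCl 2)ˣ) (a : ℤ) (k m : ℕ),
        (∀ σ, χ₀ σ = cyclotomicPadicAlgCl ℚ 2 σ ^ a) ∧ 2 ≤ k ∧ 0 < m ∧
        (∀ v : HeightOneSpectrum (𝓞 ℚ), ((2 : ℕ) : 𝓞 ℚ) ∈ v.asIdeal →
          FramedGaloisRep.IsOrdinaryOfWeightAt 2 (FramedRep.twist ρ χ₀) v k m) ∧
        ∃ n : ℕ, 0 < n ∧ ∀ σ,
          (FramedRep.det (FramedRep.twist ρ χ₀) σ *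
            (cyclotomicPadicAlgCl ℚ 2 σ ^ ((k : ℤ) - 1))⁻¹) ^ n = 1) →
      ρ.IsOdd →
      ρ.IsResiduallyAbsIrreducible →
      (∀ L : IntermediateField ℚ (AlgebraicClosure ℚ), Module.finrank ℚ L = 2 →
        (∀ σ ∈ (L.fixingSubgroup : Subgroup (absoluteGaloisGroup ℚ)),
          ∀ τ ∈ (L.fixingSubgroup : Subgroup (absoluteGaloisGroup ℚ)),
            Commute (ρ.residualRep σ) (ρ.residualRep τ)) →
        IsTotallyComplex L →
          ∃ v : HeightOneSpectrum (𝓞 ℚ), ((2 : ℕ) : 𝓞 ℚ) ∈ v.asIdeal ∧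
            (v.asIdeal.primesOver (𝓞 L)).Subsingleton) →
      (∃ (N₀ : ℕ) (_ : NeZero N₀) (k₀ : ℤ) (g : CuspForm (Gamma1 N₀) k₀)
        (ιg : coeffCharField g →+* PadicAlgCl 2) (ρg : FramedGaloisRep ℚ (PadicAlgCl 2) 2)
        (θ : absoluteGaloisGroup ℚ →ₜ* (PadicAlgCl 2)ˣ),
        2 ≤ k₀ ∧ IsNewform1 g ∧
        ‖ιg ⟨(UpperHalfPlane.qExpansion 1 ⇑g).coeff 2, cuspCoeff_mem_coeffCharField g 2⟩‖ = 1 ∧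
        IsGaloisRepOfNewform1 g ιg {q | q ∣ N₀ * 2} ρg ∧
        (∃ n : ℕ, 0 < n ∧ ∀ σ, θ σ ^ n = 1) ∧
        FramedGaloisRep.IsResidualRepOf (FramedRep.twist ρg θ) (RingHom.id _) ρ.residualRep) →
      ∃ (χ : absoluteGaloisGroup ℚ →ₜ* (PadicAlgCl 2)ˣ) (m : ℤ),
        (∀ σ, χ σ = cyclotomicPadicAlgCl ℚ 2 σ ^ m) ∧
        ∃ (N : ℕ) (_ : NeZero N) (k : ℤ) (f : CuspForm (Gamma1 N) k)
          (ιf : coeffCharField f →+* PadicAlgCl 2),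
          IsNewform1 f ∧ IsGaloisRepOfNewform1 f ιf {q | q ∣ N * 2} (FramedRep.twist ρ χ))
    (hLT : ∀ σ, langlands_tunnell σ)
    (hH : Literature.NumberTheory.EllipticCurves.Hida2000_thm326_exists_galoisRep) :
    Allen2014_modularity_nearlyOrdinaryDihedral_Q :=
  Allen2014_modularity_nearlyOrdinaryDihedral_Q_of_finalthm_of_heckeWilesLift h93
    (heckeWilesLift_of_langlands_tunnell_of_hida326 hLT hH)

end ArchitectureNoWiles

end Literature.NumberTheory.Automorphic

end
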